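import Literature.MathematicalPhysics.QuantumLattice.HubbardGridFieldSubstitution
import Literature.MathematicalPhysics.QuantumLattice.MatsubaraDeterminantBound
import Literature.MathematicalPhysics.QuantumLattice.ChronologicalGramBoundTimes
import HarnessLib

/-!
# The sharply truncated Matsubara propagator on the `4M`-point time grid: chronological kernel plus a
# uniformly small Gram kernel, and an `M`-uniform determinant bound

Topic `MathematicalPhysics/QuantumLattice`; companion of `MatsubaraDeterminantBound` (de Siqueira Pedra–Salmhofer's
determinant bound for the UNTRUNCATED time-ordered propagator, mode form) and `HubbardGridFieldSubstitution` (the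
`N`-point time grid `τ_j = jβ/N` on which the strictly frequency-conserving quartic vertex of the `2M`-frequency
Grassmann algebra is ultralocal for `N ≥ 4M - 1`).

The problem.  The Grassmann algebra of the Hubbard torus with `2M` fermionic Matsubara frequencies
`ν_n = π(2n+1)/β`, `-M ≤ n < M` (Salmhofer 1999, §4.2.4 (4.63)–(4.65); Benfatto–Giuliani–Mastropietro 2006, (2.6a))
has the SHARPLY truncated propagator `c_M(ξ; τ) = β⁻¹ Σ_{-M ≤ n < M} e^{-iν_n τ}/(-iν_n + ξ)`.  Its Gram constant
(`HubbardGridPropagatorGram`: the phase-space sum of the symbol) grows like `(1/π) log M`, and `c_M` is not a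
chronological product, so neither the Gram bound nor `norm_det_timeOrdered_modes_le` bounds its determinants
uniformly in `M` — the obstruction to an `M`-uniform single-scale ultraviolet step.

The identity (elementary, unprinted in this form; it is the Riemann-sum reading of Salmhofer's time-lattice
propagator (4.59)–(4.65) taken on the grid twice as fine as the frequency set).  On the grid of `N = 4M` times,
`ε = β/N`, the `4M` frequencies `ν_i`, `i ∈ MatsubaraIdx (2M)` (integer labels `-2M ≤ n < 2M`) are a complete set of
antiperiodic characters, and the symbol `ε/(1 - e^{(iν - ξ)ε})` resums EXACTLY to the untruncated time-ordered
propagator sampled on the grid (`gridKernel_fourier_int`):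
`β⁻¹ Σ_i e^{iν_i ε(l-j)} ε/(1 - e^{(iν_i-ξ)ε}) = [l ≤ j] e^{-ε(j-l)ξ}/(1+e^{-βξ}) - [j < l] e^{-ε(j-l)ξ}/(1+e^{βξ})`.
Hence (`truncatedPropagator_grid_eq`) `c_M = K + R` on the grid, `K` = the chronological kernel above (creation LEFT at
equal times) and `R(j, l) = β⁻¹ Σ_i e^{iν_i ε(l-j)} d_i(ξ)` a genuine Gram (convolution) kernel with symbol
`d_i(ξ) = [-M ≤ n_i < M]/(-iν_i+ξ) - ε/(1 - e^{(iν_i-ξ)ε})`, and (`norm_truncationSymbol_le`) `|d_i(ξ)| ≤ 6ε` for ALL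
`i`, `ξ ∈ ℝ`, `β > 0`: on the kept frequencies `d = -ε φ((iν-ξ)ε)` with `φ(ζ) = 1/ζ - 1/(e^ζ-1)` bounded by `6` on the
strip `|Im ζ| ≤ π/2` (`norm_inv_sub_inv_exp_sub_one_le`), off them `|1 - e^ζ| ≥ 1` because `cos(ν ε) ≤ 0`.  So
`β⁻¹ Σ_i |d_i| ≤ 6` (numerically `≈ 0.53`), uniformly in `M`, `β`, `ξ`.

The use (Pedra–Salmhofer Thm 1.3 = tree `norm_det_chronological_le_of_times'`): in a determinant
`det [Σ_m F_a(m) G_b(m) c_M(ξ_m; τ_{j_a} - τ_{l_b})]` of grid-time fields, `K` is realised mode by mode by the Gram data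
of the kernels `e^{-|ξ||z-z'|}` with weights `≤ 1` exactly as in `norm_det_timeOrdered_modes_le` (loc. cit. Lemma 4.1;
tree `timeKernel_on_eq` / `timeKernel_off_eq` with energy `d = -ξ`, which is the normal form `truncatedPropagator_grid_eq`
delivers), and `R` contributes the SAME Gram data `(F_a(m) e^{-iν_i τ_{j_a}} d_i(ξ_m) t, G_b(m) e^{iν_i τ_{l_b}}/(β t))`,
`t² = 1/(6Nε²)`, to both branches, of squared norms `≤ 6‖F_a‖², 6‖G_b‖²` by `norm_truncationSymbol_le`; the bound is
`(2(1+6))ⁿ ∏_a ‖F_a‖₂ ∏_b ‖G_b‖₂ = 14ⁿ ∏ ‖F_a‖ ∏ ‖G_b‖` for EVERY `M ≥ 1`: **`norm_det_truncatedPropagator_grid_le`** (mode form); with an extra `ℓ¹` symbol `r_m` per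
mode inside the kept-frequency sum (the covariance ABOVE an infrared region, `c_M` minus a Gram kernel) the same argument
gives `∏_a √(2Σ_m |F_a(m)|²(7+ρ_m)) ∏_b √(2Σ_m |G_b(m)|²(7+ρ_m))`, `ρ_m = β⁻¹Σ_{i'}|r_m(i')|`:
**`norm_det_truncatedPropagator_grid_add_symbol_le`**; plus an arbitrary Gram block `Σ_{m'} P_a(m') Q_b(m')` (the shape of
`norm_det_fermiTimeKernel_add_gram_le`): **`norm_det_truncatedPropagator_grid_add_gram_le`**, `14ⁿ ∏_a √(‖F_a‖²+‖P_a‖²) ∏_b √(‖G_b‖²+‖Q_b‖²)`.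

Everything is PROVED; no definition, no named fact.  NOT here: complex `ξ` (`|Im ξ| β ≤ π/4` goes through with the
same constants — TODO(general form)), off-grid times, smooth frequency cutoffs, the sharper count `β⁻¹ Σ_i |d_i| ≤ 7/2`.

## References

* W. de Siqueira Pedra, M. Salmhofer, *Determinant bounds and the Matsubara UV problem of many-fermion systems*,
  Comm. Math. Phys. 282 (2008) 797–818, Thm 1.3, Thm 2.4, Lemma 4.1. [PedraSalmhofer2008]
* M. Salmhofer, *Renormalization. An Introduction*, Springer (1999), §4.2.4 (4.54)–(4.65), App. B.5. [Salmhofer1999]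
* G. Benfatto, A. Giuliani, V. Mastropietro, Ann. Henri Poincaré 7 (2006) 809–898, §2.1 (2.6a), §2.8 (2.80).
  [BenfattoGiulianiMastropietro2006]
-/

noncomputable section

open scoped Matrix ComplexOrder
open Complex Finset Literature.Analysis.Matrix

namespace Literature.MathematicalPhysics.QuantumLattice

/-! ### (a) Two bounds on `e^ζ - 1` in the strip `|Im ζ| ≤ π/2` -/

/-- `‖exp ζ - 1‖² = e^{2x} - 2 e^x cos y + 1` (`ζ = x + iy`). [folklore] -/
private theorem norm_exp_sub_one_sq (ζ : ℂ) :
    ‖Complex.exp ζ - 1‖ ^ 2 = Real.exp ζ.re ^ 2 - 2 * Real.exp ζ.re * Real.cos ζ.im + 1 := by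
  rw [Complex.sq_norm, Complex.normSq_apply]
  simp only [Complex.sub_re, Complex.exp_re, Complex.one_re, Complex.sub_im, Complex.exp_im, Complex.one_im,
    sub_zero]
  nlinarith [Real.sin_sq_add_cos_sq ζ.im]

/-- `‖e^ζ - 1‖ ≥ 1` as soon as `cos (Im ζ) ≤ 0`, whatever `Re ζ`. [folklore] -/
private theorem one_le_norm_exp_sub_one_of_cos_nonpos (ζ : ℂ) (h : Real.cos ζ.im ≤ 0) :
    1 ≤ ‖Complex.exp ζ - 1‖ := by
  have h2 : 1 ≤ ‖Complex.exp ζ - 1‖ ^ 2 := by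
    rw [norm_exp_sub_one_sq]
    nlinarith [Real.exp_pos ζ.re, sq_nonneg (Real.exp ζ.re)]
  nlinarith [norm_nonneg (Complex.exp ζ - 1)]

/-- `cos (3/10) ≤ 0.956`. [folklore] -/
private theorem cos_three_div_ten_le : Real.cos (3 / 10) ≤ 239 / 250 := by
  have h := Real.cos_bound (x := 3 / 10) (by rw [abs_of_pos (by norm_num)]; norm_num)
  rw [abs_of_pos (by norm_num : (0:ℝ) < 3 / 10)] at h
  have := (abs_le.1 h).2
  nlinarith

/-- Away from the origin and inside the strip `|Im ζ| ≤ π/2`, `e^ζ` stays away from `1`: `‖exp ζ - 1‖ ≥ 2/7`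
(either `|Im ζ| ≥ 3/10` and `cos (Im ζ) ≤ 0.956`, or `|Re ζ| > 2/5`). [folklore] -/
private theorem two_div_seven_le_norm_exp_sub_one (ζ : ℂ) (hζ : 1 / 2 < ‖ζ‖) (him : |ζ.im| ≤ Real.pi / 2) :
    2 / 7 ≤ ‖Complex.exp ζ - 1‖ := by
  by_cases hy : 3 / 10 ≤ |ζ.im|
  · -- cos y ≤ cos (3/10) ≤ 239/250
    have hcos : Real.cos ζ.im ≤ 239 / 250 := by
      have h1 : Real.cos ζ.im = Real.cos |ζ.im| := by rw [Real.cos_abs]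
      rw [h1]
      refine (Real.cos_le_cos_of_nonneg_of_le_pi (by norm_num) ?_ hy).trans cos_three_div_ten_le
      linarith [Real.pi_pos]
    have h2 : (2 / 7 : ℝ) ^ 2 ≤ ‖Complex.exp ζ - 1‖ ^ 2 := by
      rw [norm_exp_sub_one_sq]
      nlinarith [Real.exp_pos ζ.re, sq_nonneg (Real.exp ζ.re - 239 / 250)]
    exact (pow_le_pow_iff_left₀ (by norm_num) (norm_nonneg _) two_ne_zero).1 h2
  · push Not at hy
    -- then |x| > 2/5
    have hx : 4 / 25 < ζ.re ^ 2 := by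
      have h1 : (1 / 2 : ℝ) ^ 2 < ‖ζ‖ ^ 2 := by gcongr
      rw [Complex.sq_norm, Complex.normSq_apply] at h1
      have h3 : |ζ.im| ^ 2 < (3 / 10) ^ 2 := by gcongr
      rw [sq_abs] at h3
      nlinarith
    rcases lt_or_gt_of_ne (show ζ.re ≠ 0 by intro h0; rw [h0] at hx; norm_num at hx) with hneg | hpos
    · -- x < -2/5
      have hx' : ζ.re < -(2 / 5) := by nlinarith
      have hexp : Real.exp ζ.re ≤ 5 / 7 := by
        have h1 : Real.exp ζ.re ≤ Real.exp (-(2 / 5)) := Real.exp_le_exp.2 hx'.le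
        have h2 : Real.exp (-(2 / 5 : ℝ)) ≤ 5 / 7 := by
          rw [Real.exp_neg]
          have h3 : (2 / 5 : ℝ) + 1 ≤ Real.exp (2 / 5) := Real.add_one_le_exp _
          rw [inv_le_comm₀ (Real.exp_pos _) (by norm_num)]
          linarith
        exact h1.trans h2
      calc (2 / 7 : ℝ) ≤ 1 - Real.exp ζ.re := by linarith
        _ = ‖(1 : ℂ)‖ - ‖Complex.exp ζ‖ := by rw [norm_one, Complex.norm_exp]
        _ ≤ ‖(1 : ℂ) - Complex.exp ζ‖ := norm_sub_norm_le _ _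
        _ = ‖Complex.exp ζ - 1‖ := norm_sub_rev _ _
    · have hx' : 2 / 5 < ζ.re := by nlinarith
      have hexp : 7 / 5 ≤ Real.exp ζ.re := by
        have h3 : ζ.re + 1 ≤ Real.exp ζ.re := Real.add_one_le_exp _
        linarith
      calc (2 / 7 : ℝ) ≤ Real.exp ζ.re - 1 := by linarith
        _ = ‖Complex.exp ζ‖ - ‖(1 : ℂ)‖ := by rw [norm_one, Complex.norm_exp]
        _ ≤ ‖Complex.exp ζ - 1‖ := norm_sub_norm_le _ _

/-- **The symbol `φ(ζ) = 1/ζ - 1/(e^ζ - 1)` is bounded by `6` on the strip `|Im ζ| ≤ π/2`** (`ζ ≠ 0`): for `‖ζ‖ ≤ 1/2`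
from `‖e^ζ - 1 - ζ‖ ≤ ‖ζ‖²`, otherwise from `‖ζ⁻¹‖ ≤ 2` and `‖e^ζ - 1‖ ≥ 2/7`.  (`φ` is holomorphic at `0` with `φ(0) = 1/2`;
the poles `2πiℤ \\ {0}` of `1/(e^ζ-1)` are outside the strip.) [folklore] -/
private theorem norm_inv_sub_inv_exp_sub_one_le (ζ : ℂ) (hζ : ζ ≠ 0) (him : |ζ.im| ≤ Real.pi / 2) :
    ‖ζ⁻¹ - (Complex.exp ζ - 1)⁻¹‖ ≤ 6 := by
  by_cases hsmall : ‖ζ‖ ≤ 1 / 2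
  · have hpos : 0 < ‖ζ‖ := norm_pos_iff.2 hζ
    have hT : ‖Complex.exp ζ - 1 - ζ‖ ≤ ‖ζ‖ ^ 2 := Complex.norm_exp_sub_one_sub_id_le (by linarith)
    have hE : ‖ζ‖ / 2 ≤ ‖Complex.exp ζ - 1‖ := by
      have h1 : ‖ζ‖ - ‖Complex.exp ζ - 1 - ζ‖ ≤ ‖Complex.exp ζ - 1‖ := by
        have := norm_sub_norm_le ζ (ζ - (Complex.exp ζ - 1))
        rw [sub_sub_cancel, norm_sub_rev ζ] at this
        linarith
      have h2 : ‖ζ‖ ^ 2 ≤ ‖ζ‖ / 2 := by nlinarith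
      linarith
    have hEne : Complex.exp ζ - 1 ≠ 0 := by
      intro h0; rw [h0, norm_zero] at hE; linarith
    have hid : ζ⁻¹ - (Complex.exp ζ - 1)⁻¹ = (Complex.exp ζ - 1 - ζ) / (ζ * (Complex.exp ζ - 1)) := by
      field_simp
    rw [hid, norm_div, norm_mul]
    rw [div_le_iff₀ (by positivity)]
    calc ‖Complex.exp ζ - 1 - ζ‖ ≤ ‖ζ‖ ^ 2 := hT
      _ = 2 * (‖ζ‖ * (‖ζ‖ / 2)) := by ring
      _ ≤ 2 * (‖ζ‖ * ‖Complex.exp ζ - 1‖) := by gcongr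
      _ ≤ 6 * (‖ζ‖ * ‖Complex.exp ζ - 1‖) := by nlinarith [norm_nonneg (Complex.exp ζ - 1)]
  · push Not at hsmall
    have hE : 2 / 7 ≤ ‖Complex.exp ζ - 1‖ := two_div_seven_le_norm_exp_sub_one ζ hsmall him
    have h1 : ‖ζ⁻¹‖ ≤ 2 := by
      rw [norm_inv, inv_le_comm₀ (norm_pos_iff.2 hζ) (by norm_num)]
      linarith
    have h2 : ‖(Complex.exp ζ - 1)⁻¹‖ ≤ 7 / 2 := by
      rw [norm_inv, inv_le_comm₀ (by linarith) (by norm_num)]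
      linarith
    calc ‖ζ⁻¹ - (Complex.exp ζ - 1)⁻¹‖ ≤ ‖ζ⁻¹‖ + ‖(Complex.exp ζ - 1)⁻¹‖ := norm_sub_le _ _
      _ ≤ 2 + 7 / 2 := add_le_add h1 h2
      _ ≤ 6 := by norm_num


/-! ### (b) Antiperiodic discrete Fourier analysis on the `N = 2·(2M)` time grid -/

/-- `e^{i ν_i β} = -1` for a fermionic Matsubara frequency `ν_i = π(2n+1)/β` (antiperiodicity). [cite: Salmhofer1999, §4.2.4 (4.63)] -/
theorem exp_matsubaraFreq_mul_beta_mul_I {β : ℝ} (hβ : β ≠ 0) (M : ℕ) (i : MatsubaraIdx M) :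
    Complex.exp (((matsubaraFreq β M i * β : ℝ) : ℂ) * I) = -1 := by
  have h1 : matsubaraFreq β M i * β = (matsubaraInt M i : ℝ) * (2 * Real.pi) + Real.pi := by
    rw [matsubaraFreq]; field_simp
  rw [h1]
  push_cast
  rw [add_mul, Complex.exp_add, show ((matsubaraInt M i : ℤ) : ℂ) * (2 * (Real.pi : ℂ)) * I =
    (matsubaraInt M i : ℤ) * (2 * Real.pi * I) by ring, Complex.exp_int_mul_two_pi_mul_I, one_mul,
    Complex.exp_pi_mul_I]

/-- The grid frequency sum `Σ_i e^{i ν_i ε m}` over the `N = 2·(2M)` frequencies of `MatsubaraIdx (2M)`, `ε = β/N`, for `|m| < N`: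
`N` if `m = 0`, else `0` (discrete orthogonality, Salmhofer 1999 (4.56); tree: `sum_exp_freqTransfer_gridTime`). [cite: Salmhofer1999, §4.2.4 (4.56)] -/
theorem sum_exp_matsubaraFreq_mul_eps {β : ℝ} (hβ : β ≠ 0) (M : ℕ) [NeZero M] {m : ℤ}
    (hm : m.natAbs < 2 * (2 * M)) :
    ∑ i : MatsubaraIdx (2 * M),
        Complex.exp (((matsubaraFreq β (2 * M) i * (β / (2 * (2 * M) : ℕ)) * m : ℝ) : ℂ) * I) =
      if m = 0 then ((2 * (2 * M) : ℕ) : ℂ) else 0 := by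
  set N : ℕ := 2 * (2 * M) with hN
  have hNpos : 0 < N := by rw [hN]; have := NeZero.pos M; omega
  have hNr : (N : ℝ) ≠ 0 := by exact_mod_cast hNpos.ne'
  -- prefactor `c = e^{iπm(1/N - 1)}`
  set c : ℂ := Complex.exp (((Real.pi * m / N - Real.pi * m : ℝ) : ℂ) * I) with hc
  have hterm : ∀ i : MatsubaraIdx (2 * M),
      Complex.exp (((matsubaraFreq β (2 * M) i * (β / N) * m : ℝ) : ℂ) * I) =
        c * Complex.exp (((2 * Real.pi * m * gridTime β N i / β : ℝ) : ℂ) * I) := by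
    intro i
    rw [hc, ← Complex.exp_add]
    congr 1
    have : matsubaraFreq β (2 * M) i * (β / N) * m =
        (Real.pi * m / N - Real.pi * m) + 2 * Real.pi * m * gridTime β N i / β := by
      have hNz : ((N : ℕ) : ℝ) = 2 * (2 * (M : ℝ)) := by rw [hN]; push_cast; ring
      have hMr : (M : ℝ) ≠ 0 := by exact_mod_cast (NeZero.ne M)
      rw [matsubaraFreq, matsubaraInt, gridTime, hNz]
      push_cast
      field_simp
      ring
    rw [this]
    push_cast
    ring_nf
  rw [Finset.sum_congr rfl (fun i _ => hterm i), ← Finset.mul_sum, sum_exp_freqTransfer_gridTime hβ hm]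
  split_ifs with h0
  · rw [hc, h0]; simp [hN]
  · rw [mul_zero]


/-- `|2n + 1| ≤ 2M' - 1` for the integer label `n = matsubaraInt M' i ∈ [-M', M')`. [folklore] -/
private theorem abs_two_mul_matsubaraInt_add_one_le (M' : ℕ) (i : MatsubaraIdx M') :
    |2 * (matsubaraInt M' i : ℝ) + 1| ≤ 2 * M' - 1 := by
  have hi := i.isLt
  have h1 : (matsubaraInt M' i : ℝ) = (i : ℕ) - (M' : ℝ) := by
    simp [matsubaraInt]
  rw [h1, abs_le]
  have : ((i : ℕ) : ℝ) + 1 ≤ 2 * (M' : ℝ) := by exact_mod_cast (show (i : ℕ) + 1 ≤ 2 * M' by omega)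
  have h0 : (0 : ℝ) ≤ (i : ℕ) := by positivity
  constructor <;> linarith

/-- `|ν_i ε| < π` on the `N = 2·(2M)` grid, `ε = β/N`: precisely `|ν_i ε| ≤ π (1 - 1/N)` (the frequencies (4.63) on the time lattice (4.54)). [cite: Salmhofer1999, §4.2.4 (4.63)] -/
theorem abs_matsubaraFreq_mul_eps_le {β : ℝ} (hβ : 0 < β) (M : ℕ) [NeZero M] (i : MatsubaraIdx (2 * M)) :
    |matsubaraFreq β (2 * M) i * (β / (2 * (2 * M) : ℕ))| ≤ Real.pi * (1 - 1 / (2 * (2 * M) : ℕ)) := by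
  have hMr : (0 : ℝ) < M := by exact_mod_cast NeZero.pos M
  have hN : ((2 * (2 * M) : ℕ) : ℝ) = 4 * M := by push_cast; ring
  have hab := abs_two_mul_matsubaraInt_add_one_le (2 * M) i
  push_cast at hab
  rw [hN, matsubaraFreq]
  rw [show Real.pi * (2 * (matsubaraInt (2 * M) i : ℝ) + 1) / β * (β / (4 * M)) =
    (Real.pi / (4 * M)) * (2 * (matsubaraInt (2 * M) i : ℝ) + 1) by field_simp]
  rw [abs_mul, abs_of_pos (by positivity)]
  calc Real.pi / (4 * M) * |2 * (matsubaraInt (2 * M) i : ℝ) + 1| ≤ Real.pi / (4 * M) * (2 * (2 * M : ℝ) - 1) := by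
        gcongr
    _ = Real.pi * (1 - 1 / (4 * M)) := by field_simp; ring

/-- `1 - e^{(iν_i - ξ)ε} ≠ 0` on the grid (`0 < |ν_i ε| < π`), `ξ` real: the time-lattice propagator (4.59) has no pole at the fermionic frequencies. [cite: Salmhofer1999, §4.2.4 (4.59), (4.63)] -/
theorem one_sub_exp_matsubara_eps_ne_zero {β : ℝ} (hβ : 0 < β) (ξ : ℝ) (M : ℕ) [NeZero M] (i : MatsubaraIdx (2 * M)) :
    (1 : ℂ) - Complex.exp ((((matsubaraFreq β (2 * M) i : ℝ) : ℂ) * I - (ξ : ℂ)) *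
      ((β / (2 * (2 * M) : ℕ) : ℝ) : ℂ)) ≠ 0 := by
  intro h
  have h1 : Complex.exp ((((matsubaraFreq β (2 * M) i : ℝ) : ℂ) * I - (ξ : ℂ)) *
      ((β / (2 * (2 * M) : ℕ) : ℝ) : ℂ)) = 1 := by
    rw [sub_eq_zero] at h; exact h.symm
  rw [Complex.exp_eq_one_iff] at h1
  obtain ⟨n, hn⟩ := h1
  have him := congrArg Complex.im hn
  simp only [Complex.mul_im, Complex.sub_re, Complex.mul_re, Complex.ofReal_re, Complex.I_re, mul_zero,
    Complex.ofReal_im, Complex.I_im, mul_one, sub_self, Complex.sub_im, zero_sub, Complex.mul_im,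
    Complex.re_ofNat, Complex.im_ofNat, Complex.intCast_re, Complex.intCast_im, zero_mul, add_zero,
    sub_zero, zero_add, mul_im] at him
  -- him : ν ε = n * (2π)  (up to shape); bound |ν ε| < π forces n = 0, contradiction with ν ≠ 0
  have hb := abs_matsubaraFreq_mul_eps_le hβ M i
  have hνne : matsubaraFreq β (2 * M) i ≠ 0 := matsubaraFreq_ne_zero hβ.ne' i
  have hε : (0 : ℝ) < β / (2 * (2 * M) : ℕ) := by
    have : (0 : ℝ) < (2 * (2 * M) : ℕ) := by exact_mod_cast (show 0 < 2 * (2 * M) by have := NeZero.pos M; omega)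
    positivity
  have hlt : |matsubaraFreq β (2 * M) i * (β / (2 * (2 * M) : ℕ))| < Real.pi := by
    refine hb.trans_lt ?_
    have : (0 : ℝ) < 1 / (2 * (2 * M) : ℕ) := by
      have : (0 : ℝ) < (2 * (2 * M) : ℕ) := by exact_mod_cast (show 0 < 2 * (2 * M) by have := NeZero.pos M; omega)
      positivity
    nlinarith [Real.pi_pos]
  have hprod : matsubaraFreq β (2 * M) i * (β / (2 * (2 * M) : ℕ)) = n * (2 * Real.pi) := by
    have := him
    ring_nf at this ⊢
    linarith
  rw [hprod, abs_mul, abs_of_pos (by positivity : (0:ℝ) < 2 * Real.pi)] at hlt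
  have hn0 : |(n : ℝ)| < 1 / 2 := by nlinarith [Real.pi_pos, abs_nonneg (n : ℝ)]
  have hn0' : n = 0 := by
    have : |(n : ℝ)| < 1 := by linarith
    rw [← Int.cast_abs] at this
    have : |n| < 1 := by exact_mod_cast this
    exact Int.abs_lt_one_iff.mp this
  rw [hn0'] at hprod
  have hzero : matsubaraFreq β (2 * M) i * (β / (2 * (2 * M) : ℕ)) = 0 := by rw [hprod]; simp
  rcases mul_eq_zero.1 hzero with h' | h'
  · exact hνne h'
  · exact hε.ne' h'


/-- Shift by one period in the frequency sum: `Σ_i e^{iν_i ε (m+N)} = -Σ_i e^{iν_i ε m}` (`e^{iν_iβ} = -1`, antiperiodicity). [cite: Salmhofer1999, §4.2.4 (4.63)] -/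
theorem sum_exp_matsubaraFreq_mul_eps_add {β : ℝ} (hβ : β ≠ 0) (M : ℕ) [NeZero M] (m : ℤ) :
    ∑ i : MatsubaraIdx (2 * M),
        Complex.exp (((matsubaraFreq β (2 * M) i * (β / (2 * (2 * M) : ℕ)) * (m + (2 * (2 * M) : ℕ)) : ℝ) : ℂ) * I) =
      -∑ i : MatsubaraIdx (2 * M),
        Complex.exp (((matsubaraFreq β (2 * M) i * (β / (2 * (2 * M) : ℕ)) * m : ℝ) : ℂ) * I) := by
  rw [← Finset.sum_neg_distrib]
  refine Finset.sum_congr rfl fun i _ => ?_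
  have hN : ((2 * (2 * M) : ℕ) : ℝ) ≠ 0 := by
    have : 0 < 2 * (2 * M) := by have := NeZero.pos M; omega
    positivity
  have : matsubaraFreq β (2 * M) i * (β / (2 * (2 * M) : ℕ)) * (m + (2 * (2 * M) : ℕ)) =
      matsubaraFreq β (2 * M) i * (β / (2 * (2 * M) : ℕ)) * m + matsubaraFreq β (2 * M) i * β := by
    field_simp
  rw [this]
  push_cast
  rw [add_mul, Complex.exp_add]
  have h2 := exp_matsubaraFreq_mul_beta_mul_I hβ (2 * M) i
  push_cast at h2
  rw [h2]
  ring

/-- The geometric resummation of the grid symbol: `ε/(1 - z) = (ε/(1 + e^{-βξ})) Σ_{k<N} z^k`, `z = e^{(iν - ξ)ε}`, `z^N = -e^{-βξ}`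
(the time-lattice propagator of Salmhofer 1999 (4.59) summed over one period). [cite: Salmhofer1999, §4.2.4 (4.59)–(4.65)] -/
theorem gridSymbol_eq_geom_sum {β : ℝ} (hβ : 0 < β) (ξ : ℝ) (M : ℕ) [NeZero M] (i : MatsubaraIdx (2 * M)) :
    ((β / (2 * (2 * M) : ℕ) : ℝ) : ℂ) /
        (1 - Complex.exp ((((matsubaraFreq β (2 * M) i : ℝ) : ℂ) * I - (ξ : ℂ)) * ((β / (2 * (2 * M) : ℕ) : ℝ) : ℂ))) =
      ((β / (2 * (2 * M) : ℕ) / (1 + Real.exp (-(β * ξ))) : ℝ) : ℂ) *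
        ∑ k ∈ Finset.range (2 * (2 * M)),
          (Complex.exp ((((matsubaraFreq β (2 * M) i : ℝ) : ℂ) * I - (ξ : ℂ)) * ((β / (2 * (2 * M) : ℕ) : ℝ) : ℂ))) ^ k := by
  set N : ℕ := 2 * (2 * M) with hN
  set z : ℂ := Complex.exp ((((matsubaraFreq β (2 * M) i : ℝ) : ℂ) * I - (ξ : ℂ)) * ((β / N : ℝ) : ℂ)) with hz
  have hNpos : 0 < N := by rw [hN]; have := NeZero.pos M; omega
  have hNr : (N : ℝ) ≠ 0 := by exact_mod_cast hNpos.ne'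
  have hz1 : z ≠ 1 := by
    intro h
    exact one_sub_exp_matsubara_eps_ne_zero hβ ξ M i (by rw [← hz, h, sub_self])
  have hNc : (N : ℂ) ≠ 0 := by exact_mod_cast hNpos.ne'
  have hzN : z ^ N = -((Real.exp (-(β * ξ)) : ℝ) : ℂ) := by
    rw [hz, ← Complex.exp_nat_mul]
    have : (N : ℂ) * ((((matsubaraFreq β (2 * M) i : ℝ) : ℂ) * I - (ξ : ℂ)) * ((β / N : ℝ) : ℂ)) =
        ((matsubaraFreq β (2 * M) i * β : ℝ) : ℂ) * I + ((-(β * ξ) : ℝ) : ℂ) := by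
      rw [Complex.ofReal_div, Complex.ofReal_natCast, Complex.ofReal_mul, Complex.ofReal_neg, Complex.ofReal_mul]
      field_simp
      ring
    rw [this, Complex.exp_add, exp_matsubaraFreq_mul_beta_mul_I hβ.ne', Complex.ofReal_exp]
    ring
  have hgeom := geom_sum_eq hz1 N
  rw [hzN] at hgeom
  rw [hgeom]
  have h1z : (1 : ℂ) - z ≠ 0 := sub_ne_zero.2 (Ne.symm hz1)
  have hz1' : z - 1 ≠ 0 := sub_ne_zero.2 hz1
  have hpos : (1 : ℝ) + Real.exp (-(β * ξ)) ≠ 0 := by positivity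
  set E : ℂ := ((Real.exp (-(β * ξ)) : ℝ) : ℂ) with hE
  have h1E : (1 : ℂ) + E ≠ 0 := by rw [hE]; exact_mod_cast hpos
  have hcast : (((β / N / (1 + Real.exp (-(β * ξ)))) : ℝ) : ℂ) = ((β : ℂ) / (N : ℂ)) / (1 + E) := by
    rw [hE]; push_cast; ring
  rw [hcast]
  have hcast2 : (((β / N : ℝ)) : ℂ) = (β : ℂ) / (N : ℂ) := by push_cast; ring
  rw [hcast2]
  field_simp
  ring


/-- The frequency sum with shifts resolved: for `-N < m < 2N` (`N = 2·(2M)`),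
`Σ_i e^{iν_i ε m} = N·[m = 0] - N·[m = N]` (antiperiodic discrete orthogonality). [cite: Salmhofer1999, §4.2.4 (4.56), (4.63)] -/
theorem sum_exp_matsubaraFreq_mul_eps_eq {β : ℝ} (hβ : β ≠ 0) (M : ℕ) [NeZero M] {m : ℤ}
    (hm1 : -((2 * (2 * M) : ℕ) : ℤ) < m) (hm2 : m < 2 * ((2 * (2 * M) : ℕ) : ℤ)) :
    ∑ i : MatsubaraIdx (2 * M),
        Complex.exp (((matsubaraFreq β (2 * M) i * (β / (2 * (2 * M) : ℕ)) * m : ℝ) : ℂ) * I) =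
      if m = 0 then ((2 * (2 * M) : ℕ) : ℂ)
      else if m = ((2 * (2 * M) : ℕ) : ℤ) then -((2 * (2 * M) : ℕ) : ℂ) else 0 := by
  have hNpos : 0 < 2 * (2 * M) := by have := NeZero.pos M; omega
  by_cases hlt : m < ((2 * (2 * M) : ℕ) : ℤ)
  · have hm : m.natAbs < 2 * (2 * M) := by omega
    rw [sum_exp_matsubaraFreq_mul_eps hβ M hm]
    by_cases h0 : m = 0
    · simp [h0]
    · have hne : ¬ m = ((2 * (2 * M) : ℕ) : ℤ) := by omega
      rw [if_neg h0, if_neg h0, if_neg hne]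
  · -- `N ≤ m < 2N`: shift
    push Not at hlt
    obtain ⟨m', rfl⟩ : ∃ m', m = m' + ((2 * (2 * M) : ℕ) : ℤ) := ⟨m - (2 * (2 * M) : ℕ), by ring⟩
    have hm' : m'.natAbs < 2 * (2 * M) := by omega
    have h := sum_exp_matsubaraFreq_mul_eps_add hβ M m'
    have hcast : ∀ i : MatsubaraIdx (2 * M),
        (matsubaraFreq β (2 * M) i * (β / (2 * (2 * M) : ℕ)) * ((m' + ((2 * (2 * M) : ℕ) : ℤ) : ℤ) : ℝ)) =
          matsubaraFreq β (2 * M) i * (β / (2 * (2 * M) : ℕ)) * ((m' : ℝ) + (2 * (2 * M) : ℕ)) := by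
      intro i; push_cast; ring
    simp_rw [hcast]
    rw [h, sum_exp_matsubaraFreq_mul_eps hβ M hm']
    have h1 : ¬ m' + ((2 * (2 * M) : ℕ) : ℤ) = 0 := by omega
    rw [if_neg h1]
    by_cases h0 : m' = 0
    · rw [if_pos h0, if_pos (by rw [h0]; ring)]
    · have h2 : ¬ m' + ((2 * (2 * M) : ℕ) : ℤ) = ((2 * (2 * M) : ℕ) : ℤ) := by omega
      rw [if_neg h0, if_neg h2, neg_zero]

/-- **The grid-sampled chronological kernel is an EXACT `N`-grid Fourier sum** (`N = 2·(2M)`, `ε = β/N`, frequencies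
`ν_i`, `i ∈ MatsubaraIdx (2M)`), integer form: for grid indices `j, l < N`,
`β⁻¹ Σ_i e^{iν_i ε (l - j)} · ε/(1 - e^{(iν_i - ξ)ε}) = [l ≤ j] e^{-ε(j-l)ξ}/(1+e^{-βξ}) - [j < l] e^{-ε(j-l)ξ}/(1+e^{βξ})`
(the untruncated time-ordered free propagator `C(τ, ξ)` of Pedra–Salmhofer §4.1 / BGM (2.7) sampled at `τ = ε(j-l)`, creation LEFT at
equal times).  Proof: `ε/(1-z_i) = ε(1+e^{-βξ})⁻¹ Σ_{k<N} z_i^k` and `Σ_i e^{iν_i ε(k-j+l)} = N[k = j-l] - N[k = N+j-l]`; elementary,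
unprinted in this form (Salmhofer 1999 (4.59)–(4.65) is the time-lattice propagator whose `ε → 0` limit is `C`). [cite: Salmhofer1999, §4.2.4 (4.59)–(4.65)] -/
theorem gridKernel_fourier_int {β : ℝ} (hβ : 0 < β) (ξ : ℝ) (M : ℕ) [NeZero M] {j l : ℕ}
    (hj : j < 2 * (2 * M)) (hl : l < 2 * (2 * M)) :
    ((1 / β : ℝ) : ℂ) * ∑ i : MatsubaraIdx (2 * M),
        Complex.exp (((matsubaraFreq β (2 * M) i * (β / (2 * (2 * M) : ℕ)) * (((l : ℤ) - j : ℤ) : ℝ) : ℝ) : ℂ) * I) *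
          (((β / (2 * (2 * M) : ℕ) : ℝ) : ℂ) /
            (1 - Complex.exp ((((matsubaraFreq β (2 * M) i : ℝ) : ℂ) * I - (ξ : ℂ)) *
              ((β / (2 * (2 * M) : ℕ) : ℝ) : ℂ)))) =
      if l ≤ j then
        ((Real.exp (-(β / (2 * (2 * M) : ℕ) * ((j : ℝ) - l) * ξ)) / (1 + Real.exp (-(β * ξ))) : ℝ) : ℂ)
      else
        -((Real.exp (-(β / (2 * (2 * M) : ℕ) * ((j : ℝ) - l) * ξ)) / (1 + Real.exp (β * ξ)) : ℝ) : ℂ) := by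
  have hNpos : 0 < 2 * (2 * M) := by have := NeZero.pos M; omega
  have hNr : ((2 * (2 * M) : ℕ) : ℝ) ≠ 0 := by exact_mod_cast hNpos.ne'
  set ε : ℝ := β / (2 * (2 * M) : ℕ) with hε
  have hεN : ε * (2 * (2 * M) : ℕ) = β := by rw [hε]; field_simp
  have hS_eval : ∀ m : ℤ, -((2 * (2 * M) : ℕ) : ℤ) < m → m < 2 * ((2 * (2 * M) : ℕ) : ℤ) →
      ∑ i : MatsubaraIdx (2 * M), Complex.exp (((matsubaraFreq β (2 * M) i * ε * m : ℝ) : ℂ) * I) =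
        if m = 0 then ((2 * (2 * M) : ℕ) : ℂ)
        else if m = ((2 * (2 * M) : ℕ) : ℤ) then -((2 * (2 * M) : ℕ) : ℂ) else 0 := by
    intro m hm1 hm2
    rw [hε]
    exact sum_exp_matsubaraFreq_mul_eps_eq hβ.ne' M hm1 hm2
  -- step 1: resum each `ε/(1-z_i)` and recombine the exponentials
  have hterm : ∀ i : MatsubaraIdx (2 * M),
      Complex.exp (((matsubaraFreq β (2 * M) i * ε * (((l : ℤ) - j : ℤ) : ℝ) : ℝ) : ℂ) * I) *
          (((ε : ℝ) : ℂ) / (1 - Complex.exp ((((matsubaraFreq β (2 * M) i : ℝ) : ℂ) * I - (ξ : ℂ)) * ((ε : ℝ) : ℂ)))) =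
        ((ε / (1 + Real.exp (-(β * ξ))) : ℝ) : ℂ) *
          ∑ k ∈ Finset.range (2 * (2 * M)),
            Complex.exp (((matsubaraFreq β (2 * M) i * ε * ((k : ℤ) - j + l : ℤ) : ℝ) : ℂ) * I) *
              ((Real.exp (-(ξ * ε * k)) : ℝ) : ℂ) := by
    intro i
    have hg := gridSymbol_eq_geom_sum hβ ξ M i
    rw [← hε] at hg
    rw [hg, Finset.mul_sum, Finset.mul_sum, Finset.mul_sum]
    refine Finset.sum_congr rfl fun k _ => ?_
    have hzk : (Complex.exp ((((matsubaraFreq β (2 * M) i : ℝ) : ℂ) * I - (ξ : ℂ)) * ((ε : ℝ) : ℂ))) ^ k =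
        Complex.exp (((matsubaraFreq β (2 * M) i * ε * k : ℝ) : ℂ) * I) * ((Real.exp (-(ξ * ε * k)) : ℝ) : ℂ) := by
      rw [← Complex.exp_nat_mul, Complex.ofReal_exp, ← Complex.exp_add]
      congr 1
      push_cast
      ring
    rw [hzk]
    have hexp : Complex.exp (((matsubaraFreq β (2 * M) i * ε * (((l : ℤ) - j : ℤ) : ℝ) : ℝ) : ℂ) * I) *
        Complex.exp (((matsubaraFreq β (2 * M) i * ε * k : ℝ) : ℂ) * I) =
        Complex.exp (((matsubaraFreq β (2 * M) i * ε * ((k : ℤ) - j + l : ℤ) : ℝ) : ℂ) * I) := by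
      rw [← Complex.exp_add]
      congr 1
      push_cast
      ring
    rw [← hexp]
    ring
  rw [Finset.sum_congr rfl (fun i _ => hterm i), ← Finset.mul_sum, Finset.sum_comm]
  -- the inner sum over `i` is `S (k - j + l)` times a `k`-dependent real factor
  have hinner : ∀ k ∈ Finset.range (2 * (2 * M)),
      ∑ i : MatsubaraIdx (2 * M), Complex.exp (((matsubaraFreq β (2 * M) i * ε * ((k : ℤ) - j + l : ℤ) : ℝ) : ℂ) * I) *
          ((Real.exp (-(ξ * ε * k)) : ℝ) : ℂ) =
        ((Real.exp (-(ξ * ε * k)) : ℝ) : ℂ) *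
          ∑ i : MatsubaraIdx (2 * M), Complex.exp (((matsubaraFreq β (2 * M) i * ε * ((k : ℤ) - j + l : ℤ) : ℝ) : ℂ) * I) := by
    intro k hk
    rw [Finset.mul_sum]
    refine Finset.sum_congr rfl fun i _ => ?_
    ring
  rw [Finset.sum_congr rfl hinner]
  have hβc : (β : ℂ) ≠ 0 := by exact_mod_cast hβ.ne'
  have hNc : ((2 * (2 * M) : ℕ) : ℂ) ≠ 0 := by exact_mod_cast hNpos.ne'
  have hEm : (1 : ℂ) + ((Real.exp (-(β * ξ)) : ℝ) : ℂ) ≠ 0 := by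
    have : (0 : ℝ) < 1 + Real.exp (-(β * ξ)) := by positivity
    exact_mod_cast this.ne'
  have hEp : (1 : ℂ) + ((Real.exp (β * ξ) : ℝ) : ℂ) ≠ 0 := by
    have : (0 : ℝ) < 1 + Real.exp (β * ξ) := by positivity
    exact_mod_cast this.ne'
  split_ifs with hlj
  · -- only `k = j - l` contributes, with `S 0 = N`
    have hval : ∀ k ∈ Finset.range (2 * (2 * M)),
        ((Real.exp (-(ξ * ε * k)) : ℝ) : ℂ) *
            ∑ i : MatsubaraIdx (2 * M), Complex.exp (((matsubaraFreq β (2 * M) i * ε * ((k : ℤ) - j + l : ℤ) : ℝ) : ℂ) * I) =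
          if k = j - l then ((Real.exp (-(ξ * ε * ((j - l : ℕ) : ℝ))) : ℝ) : ℂ) * ((2 * (2 * M) : ℕ) : ℂ) else 0 := by
      intro k hk
      rw [Finset.mem_range] at hk
      rw [hS_eval _ (by omega) (by omega)]
      by_cases hk0 : k = j - l
      · have : ((k : ℤ) - j + l) = 0 := by omega
        rw [if_pos this, if_pos hk0, hk0]
      · have h1 : ¬ ((k : ℤ) - j + l) = 0 := by omega
        have h2 : ¬ ((k : ℤ) - j + l) = ((2 * (2 * M) : ℕ) : ℤ) := by omega
        rw [if_neg h1, if_neg h2, if_neg hk0, mul_zero]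
    rw [Finset.sum_congr rfl hval, Finset.sum_ite_eq' (Finset.range (2 * (2 * M)))]
    rw [if_pos (by rw [Finset.mem_range]; omega)]
    have hcast : ((j - l : ℕ) : ℝ) = (j : ℝ) - l := by rw [Nat.cast_sub hlj]
    rw [hcast]
    -- both sides as casts of real numbers
    rw [show ((Real.exp (-(ξ * ε * ((j : ℝ) - l))) : ℝ) : ℂ) * ((2 * (2 * M) : ℕ) : ℂ) =
        (((Real.exp (-(ξ * ε * ((j : ℝ) - l))) * (2 * (2 * M) : ℕ) : ℝ)) : ℂ) by push_cast; ring]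
    rw [← Complex.ofReal_mul, ← Complex.ofReal_mul]
    congr 1
    rw [show -(ε * ((j : ℝ) - l) * ξ) = -(ξ * ε * ((j : ℝ) - l)) by ring]
    field_simp
    rw [hε]
    field_simp
  · -- only `k = N + j - l` contributes, with `S N = -N`
    push Not at hlj
    have hval : ∀ k ∈ Finset.range (2 * (2 * M)),
        ((Real.exp (-(ξ * ε * k)) : ℝ) : ℂ) *
            ∑ i : MatsubaraIdx (2 * M), Complex.exp (((matsubaraFreq β (2 * M) i * ε * ((k : ℤ) - j + l : ℤ) : ℝ) : ℂ) * I) =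
          if k = 2 * (2 * M) + j - l then
            -(((Real.exp (-(ξ * ε * ((2 * (2 * M) + j - l : ℕ) : ℝ))) : ℝ) : ℂ) * ((2 * (2 * M) : ℕ) : ℂ)) else 0 := by
      intro k hk
      rw [Finset.mem_range] at hk
      rw [hS_eval _ (by omega) (by omega)]
      by_cases hk0 : k = 2 * (2 * M) + j - l
      · have h1 : ¬ ((k : ℤ) - j + l) = 0 := by omega
        have h2 : ((k : ℤ) - j + l) = ((2 * (2 * M) : ℕ) : ℤ) := by omega
        rw [if_neg h1, if_pos h2, if_pos hk0, hk0, mul_neg]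
      · have h1 : ¬ ((k : ℤ) - j + l) = 0 := by omega
        have h2 : ¬ ((k : ℤ) - j + l) = ((2 * (2 * M) : ℕ) : ℤ) := by omega
        rw [if_neg h1, if_neg h2, if_neg hk0, mul_zero]
    rw [Finset.sum_congr rfl hval, Finset.sum_ite_eq' (Finset.range (2 * (2 * M)))]
    rw [if_pos (by rw [Finset.mem_range]; omega)]
    have hcast : ((2 * (2 * M) + j - l : ℕ) : ℝ) = ((2 * (2 * M) : ℕ) : ℝ) + j - l := by
      rw [Nat.cast_sub (by omega)]; push_cast; ring
    rw [hcast]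
    -- `e^{-ξ ε (N + j - l)} = e^{-βξ} e^{-ξ ε (j - l)}` and `e^{-βξ}/(1+e^{-βξ}) = 1/(1+e^{βξ})`
    have key : Real.exp (-(ξ * ε * (((2 * (2 * M) : ℕ) : ℝ) + j - l))) =
        Real.exp (-(β * ξ)) * Real.exp (-(ε * ((j : ℝ) - l) * ξ)) := by
      rw [← Real.exp_add]; congr 1
      have : ξ * ε * ((2 * (2 * M) : ℕ) : ℝ) = β * ξ := by rw [hε]; field_simp
      linear_combination -this
    rw [key]
    rw [show -(((Real.exp (-(β * ξ)) * Real.exp (-(ε * ((j : ℝ) - l) * ξ)) : ℝ) : ℂ) * ((2 * (2 * M) : ℕ) : ℂ)) =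
        (((-(Real.exp (-(β * ξ)) * Real.exp (-(ε * ((j : ℝ) - l) * ξ)) * (2 * (2 * M) : ℕ))) : ℝ) : ℂ) by push_cast; ring]
    rw [← Complex.ofReal_mul, ← Complex.ofReal_mul, ← Complex.ofReal_neg]
    congr 1
    have hE1 : (1 : ℝ) + Real.exp (-(β * ξ)) ≠ 0 := by positivity
    have hE2 : (1 : ℝ) + Real.exp (β * ξ) ≠ 0 := by positivity
    have hprod : Real.exp (-(β * ξ)) * Real.exp (β * ξ) = 1 := by rw [← Real.exp_add]; simp
    field_simp
    rw [hε]
    field_simp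
    linear_combination (-1 : ℝ) * hprod


/-! ### (c) The kept frequencies inside the doubled set, and the remainder symbol `d_i(ξ)` -/

/-- The `2M` frequencies of `MatsubaraIdx M` are the middle block `M ≤ i < 3M` of the `4M` frequencies of `MatsubaraIdx (2M)`
(`n = i' - M = (i' + M) - 2M`): reindexing of sums. [cite: Salmhofer1999, §4.2.4 (4.63)] -/
theorem sum_matsubaraIdx_eq_sum_ite (M : ℕ) [NeZero M] (β : ℝ) (g : ℝ → ℂ) :
    ∑ i' : MatsubaraIdx M, g (matsubaraFreq β M i') =
      ∑ i : MatsubaraIdx (2 * M), if M ≤ (i : ℕ) ∧ (i : ℕ) < 3 * M then g (matsubaraFreq β (2 * M) i) else 0 := by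
  have hM := NeZero.pos M
  rw [← Finset.sum_filter]
  refine Finset.sum_nbij' (fun i' => (⟨(i' : ℕ) + M, by have := i'.isLt; omega⟩ : MatsubaraIdx (2 * M)))
    (fun i => (⟨((i : ℕ) - M) % (2 * M), Nat.mod_lt _ (by omega)⟩ : MatsubaraIdx M)) ?_ ?_ ?_ ?_ ?_
  · intro i' _
    have := i'.isLt
    simp only [Finset.mem_filter, Finset.mem_univ, true_and]
    omega
  · intro i _
    exact Finset.mem_univ _
  · intro i' _
    have := i'.isLt
    ext
    simp only [Nat.add_sub_cancel]
    exact Nat.mod_eq_of_lt this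
  · intro i hi
    simp only [Finset.mem_filter, Finset.mem_univ, true_and] at hi
    ext
    simp only
    rw [Nat.mod_eq_of_lt (by omega)]
    omega
  · intro i' _
    congr 1
    simp only [matsubaraFreq, matsubaraInt]
    push_cast
    ring

/-- `ν_i ε = π(2n_i + 1)/N` on the grid `ε = β/N`, `N = 2·(2M)`. [cite: Salmhofer1999, §4.2.4 (4.63)] -/
theorem matsubaraFreq_mul_eps_eq {β : ℝ} (hβ : β ≠ 0) (M : ℕ) [NeZero M] (i : MatsubaraIdx (2 * M)) :
    matsubaraFreq β (2 * M) i * (β / (2 * (2 * M) : ℕ)) =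
      Real.pi * (2 * (matsubaraInt (2 * M) i : ℝ) + 1) / (2 * (2 * M) : ℕ) := by
  have hN : ((2 * (2 * M) : ℕ) : ℝ) ≠ 0 := by
    have : 0 < 2 * (2 * M) := by have := NeZero.pos M; omega
    positivity
  rw [matsubaraFreq]
  field_simp

/-- On the kept block `M ≤ i < 3M` (`-M ≤ n < M`, the frequencies (4.63) of the `2M`-set), `|ν_i ε| ≤ π/2` (precisely `≤ π(2M-1)/(4M)`). [cite: Salmhofer1999, §4.2.4 (4.63)] -/
theorem abs_matsubaraFreq_mul_eps_le_pi_div_two {β : ℝ} (hβ : β ≠ 0) (M : ℕ) [NeZero M] (i : MatsubaraIdx (2 * M))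
    (hi : M ≤ (i : ℕ) ∧ (i : ℕ) < 3 * M) :
    |matsubaraFreq β (2 * M) i * (β / (2 * (2 * M) : ℕ))| ≤ Real.pi / 2 := by
  rw [matsubaraFreq_mul_eps_eq hβ M i]
  have hMr : (0 : ℝ) < M := by exact_mod_cast NeZero.pos M
  have hN : ((2 * (2 * M) : ℕ) : ℝ) = 4 * M := by push_cast; ring
  have h1 : |2 * (matsubaraInt (2 * M) i : ℝ) + 1| ≤ 2 * M - 1 := by
    have h0 : (matsubaraInt (2 * M) i : ℝ) = ((i : ℕ) : ℝ) - 2 * M := by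
      simp only [matsubaraInt]; push_cast; ring
    rw [h0, abs_le]
    obtain ⟨hi1, hi2⟩ := hi
    have hi1' : (M : ℝ) ≤ (i : ℕ) := by exact_mod_cast hi1
    have hi2' : ((i : ℕ) : ℝ) + 1 ≤ 3 * M := by exact_mod_cast (show (i : ℕ) + 1 ≤ 3 * M by omega)
    constructor <;> linarith
  rw [hN, abs_div, abs_of_pos (by positivity : (0 : ℝ) < 4 * M), abs_mul, abs_of_pos Real.pi_pos,
    div_le_div_iff₀ (by positivity) (by norm_num : (0 : ℝ) < 2)]
  nlinarith [Real.pi_pos, h1, abs_nonneg (2 * (matsubaraInt (2 * M) i : ℝ) + 1)]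

/-- Off the kept block (`n < -M` or `n ≥ M`), `π/2 ≤ |ν_i ε|` (precisely `≥ π(2M+1)/(4M)`). [cite: Salmhofer1999, §4.2.4 (4.63)] -/
theorem pi_div_two_le_abs_matsubaraFreq_mul_eps {β : ℝ} (hβ : β ≠ 0) (M : ℕ) [NeZero M] (i : MatsubaraIdx (2 * M))
    (hi : ¬ (M ≤ (i : ℕ) ∧ (i : ℕ) < 3 * M)) :
    Real.pi / 2 ≤ |matsubaraFreq β (2 * M) i * (β / (2 * (2 * M) : ℕ))| := by
  rw [matsubaraFreq_mul_eps_eq hβ M i]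
  have hMr : (0 : ℝ) < M := by exact_mod_cast NeZero.pos M
  have hN : ((2 * (2 * M) : ℕ) : ℝ) = 4 * M := by push_cast; ring
  have h1 : 2 * (M : ℝ) + 1 ≤ |2 * (matsubaraInt (2 * M) i : ℝ) + 1| := by
    have h0 : (matsubaraInt (2 * M) i : ℝ) = ((i : ℕ) : ℝ) - 2 * M := by
      simp only [matsubaraInt]; push_cast; ring
    rw [h0]
    have hi2 := i.isLt
    rcases Nat.lt_or_ge (i : ℕ) M with h | h
    · have h' : ((i : ℕ) : ℝ) + 1 ≤ M := by exact_mod_cast h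
      rw [abs_of_neg (by linarith)]
      linarith
    · have h3 : 3 * M ≤ (i : ℕ) := by omega
      have h' : (3 * M : ℝ) ≤ (i : ℕ) := by exact_mod_cast h3
      rw [abs_of_pos (by linarith)]
      linarith
  rw [hN, abs_div, abs_of_pos (by positivity : (0 : ℝ) < 4 * M), abs_mul, abs_of_pos Real.pi_pos,
    div_le_div_iff₀ (by norm_num : (0 : ℝ) < 2) (by positivity)]
  nlinarith [Real.pi_pos, h1]

/-- Off the kept block, `cos (ν_i ε) ≤ 0` (`π/2 ≤ |ν_i ε| < π`). [cite: Salmhofer1999, §4.2.4 (4.63)] -/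
theorem cos_matsubaraFreq_mul_eps_nonpos {β : ℝ} (hβ : 0 < β) (M : ℕ) [NeZero M] (i : MatsubaraIdx (2 * M))
    (hi : ¬ (M ≤ (i : ℕ) ∧ (i : ℕ) < 3 * M)) :
    Real.cos (matsubaraFreq β (2 * M) i * (β / (2 * (2 * M) : ℕ))) ≤ 0 := by
  rw [← Real.cos_abs]
  refine Real.cos_nonpos_of_pi_div_two_le_of_le (pi_div_two_le_abs_matsubaraFreq_mul_eps hβ.ne' M i hi) ?_
  refine (abs_matsubaraFreq_mul_eps_le hβ M i).trans ?_
  have : (0 : ℝ) ≤ 1 / (2 * (2 * M) : ℕ) := by positivity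
  nlinarith [Real.pi_pos]

/-- **The remainder symbol is `O(ε)` uniformly**: with `ν = ν_i`, `ε = β/N`, `N = 2·(2M)`,
`d_i(ξ) = [M ≤ i < 3M]/(-iν + ξ) - ε/(1 - e^{(iν - ξ)ε})` satisfies `|d_i(ξ)| ≤ 6ε` for every `i`, real `ξ`, `β > 0`:
on the kept block `d = -ε φ((iν-ξ)ε)`, `φ(ζ) = 1/ζ - 1/(e^ζ-1)`, `|Im ζ| = |νε| ≤ π/2`; off it `|1 - e^ζ| ≥ 1` since `cos(νε) ≤ 0`.
Elementary, unprinted; the mechanism (the time-lattice propagator `(4.59)` differs from the continuum one by `O(ε)` symbols) is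
Salmhofer 1999, §4.2.4. [cite: Salmhofer1999, §4.2.4 (4.59)–(4.65)] -/
theorem norm_truncationSymbol_le {β : ℝ} (hβ : 0 < β) (ξ : ℝ) (M : ℕ) [NeZero M] (i : MatsubaraIdx (2 * M)) :
    ‖(if M ≤ (i : ℕ) ∧ (i : ℕ) < 3 * M then
          (1 : ℂ) / (-((matsubaraFreq β (2 * M) i : ℝ) : ℂ) * I + (ξ : ℂ)) else 0) -
        ((β / (2 * (2 * M) : ℕ) : ℝ) : ℂ) /
          (1 - Complex.exp ((((matsubaraFreq β (2 * M) i : ℝ) : ℂ) * I - (ξ : ℂ)) *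
            ((β / (2 * (2 * M) : ℕ) : ℝ) : ℂ)))‖ ≤
      6 * (β / (2 * (2 * M) : ℕ)) := by
  have h1z := one_sub_exp_matsubara_eps_ne_zero hβ ξ M i
  have hν0 : matsubaraFreq β (2 * M) i ≠ 0 := matsubaraFreq_ne_zero hβ.ne' i
  set ν : ℝ := matsubaraFreq β (2 * M) i with hν
  set ε : ℝ := β / (2 * (2 * M) : ℕ) with hε
  have hNpos : 0 < 2 * (2 * M) := by have := NeZero.pos M; omega
  have hε0 : 0 < ε := by
    have : (0 : ℝ) < (2 * (2 * M) : ℕ) := by exact_mod_cast hNpos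
    positivity
  have hζim : ((((ν : ℝ) : ℂ) * I - (ξ : ℂ)) * ((ε : ℝ) : ℂ)).im = ν * ε := by
    simp [Complex.mul_im, Complex.mul_re]
  split_ifs with hi
  · -- on the kept block: `d = -ε φ(ζ)`, `ζ = (iν - ξ)ε = -(-iν + ξ)ε`
    have him : |((((ν : ℝ) : ℂ) * I - (ξ : ℂ)) * ((ε : ℝ) : ℂ)).im| ≤ Real.pi / 2 := by
      rw [hζim]; exact abs_matsubaraFreq_mul_eps_le_pi_div_two hβ.ne' M i hi
    have hεc : ((ε : ℝ) : ℂ) ≠ 0 := by exact_mod_cast hε0.ne'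
    have hA : (-((ν : ℝ) : ℂ) * I + (ξ : ℂ)) ≠ 0 := by
      intro h
      have := congrArg Complex.im h
      simp at this
      exact hν0 this
    have hζ0 : (((ν : ℝ) : ℂ) * I - (ξ : ℂ)) * ((ε : ℝ) : ℂ) ≠ 0 := by
      intro h
      have := congrArg Complex.im h
      rw [hζim, Complex.zero_im] at this
      exact (mul_ne_zero hν0 hε0.ne') this
    have hE : Complex.exp ((((ν : ℝ) : ℂ) * I - (ξ : ℂ)) * ((ε : ℝ) : ℂ)) - 1 ≠ 0 := by
      intro h
      apply h1z
      rw [sub_eq_zero] at h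
      rw [h, sub_self]
    have key : (1 : ℂ) / (-((ν : ℝ) : ℂ) * I + (ξ : ℂ)) -
        ((ε : ℝ) : ℂ) / (1 - Complex.exp ((((ν : ℝ) : ℂ) * I - (ξ : ℂ)) * ((ε : ℝ) : ℂ))) =
        -((ε : ℝ) : ℂ) * (((((ν : ℝ) : ℂ) * I - (ξ : ℂ)) * ((ε : ℝ) : ℂ))⁻¹ -
          (Complex.exp ((((ν : ℝ) : ℂ) * I - (ξ : ℂ)) * ((ε : ℝ) : ℂ)) - 1)⁻¹) := by
      have hζ' : (((ν : ℝ) : ℂ) * I - (ξ : ℂ)) * ((ε : ℝ) : ℂ) = -((-((ν : ℝ) : ℂ) * I + (ξ : ℂ)) * ((ε : ℝ) : ℂ)) := by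
        ring
      set Z : ℂ := Complex.exp ((((ν : ℝ) : ℂ) * I - (ξ : ℂ)) * ((ε : ℝ) : ℂ)) with hZ
      have h1Z : (1 : ℂ) - Z ≠ 0 := h1z
      have hZ1 : Z - 1 ≠ 0 := hE
      rw [hζ']
      field_simp
      ring
    rw [key, norm_mul, norm_neg, Complex.norm_real, Real.norm_of_nonneg hε0.le]
    calc ε * ‖((((ν : ℝ) : ℂ) * I - (ξ : ℂ)) * ((ε : ℝ) : ℂ))⁻¹ -
          (Complex.exp ((((ν : ℝ) : ℂ) * I - (ξ : ℂ)) * ((ε : ℝ) : ℂ)) - 1)⁻¹‖ ≤ ε * 6 := by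
          gcongr
          exact norm_inv_sub_inv_exp_sub_one_le _ hζ0 him
      _ = 6 * ε := by ring
  · -- off the kept block: `|d| = ε/|1 - e^ζ| ≤ ε`
    rw [zero_sub, norm_neg, norm_div, Complex.norm_real, Real.norm_of_nonneg hε0.le]
    have hcos : Real.cos ((((ν : ℝ) : ℂ) * I - (ξ : ℂ)) * ((ε : ℝ) : ℂ)).im ≤ 0 := by
      rw [hζim]; exact cos_matsubaraFreq_mul_eps_nonpos hβ M i hi
    have h1 : 1 ≤ ‖(1 : ℂ) - Complex.exp ((((ν : ℝ) : ℂ) * I - (ξ : ℂ)) * ((ε : ℝ) : ℂ))‖ := by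
      rw [norm_sub_rev]; exact one_le_norm_exp_sub_one_of_cos_nonpos _ hcos
    calc ε / ‖(1 : ℂ) - Complex.exp ((((ν : ℝ) : ℂ) * I - (ξ : ℂ)) * ((ε : ℝ) : ℂ))‖ ≤ ε / 1 :=
          div_le_div_of_nonneg_left hε0.le one_pos h1
      _ ≤ 6 * ε := by linarith

/-- The `ℓ¹` form: **`β⁻¹ Σ_i |d_i(ξ)| ≤ 6`** over the `4M` frequencies, uniformly in `M ≥ 1`, `β > 0`, `ξ ∈ ℝ` (the Gram constant
of the remainder kernel `R`; counting the two blocks separately gives `7/2`, numerically `≈ 0.53`). [cite: Salmhofer1999, §4.2.4 (4.59)–(4.65)] -/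
theorem inv_beta_mul_sum_norm_truncationSymbol_le {β : ℝ} (hβ : 0 < β) (ξ : ℝ) (M : ℕ) [NeZero M] :
    1 / β * ∑ i : MatsubaraIdx (2 * M),
        ‖(if M ≤ (i : ℕ) ∧ (i : ℕ) < 3 * M then
              (1 : ℂ) / (-((matsubaraFreq β (2 * M) i : ℝ) : ℂ) * I + (ξ : ℂ)) else 0) -
            ((β / (2 * (2 * M) : ℕ) : ℝ) : ℂ) /
              (1 - Complex.exp ((((matsubaraFreq β (2 * M) i : ℝ) : ℂ) * I - (ξ : ℂ)) *
                ((β / (2 * (2 * M) : ℕ) : ℝ) : ℂ)))‖ ≤ 6 := by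
  have hNpos : 0 < 2 * (2 * M) := by have := NeZero.pos M; omega
  have hNr : (0 : ℝ) < (2 * (2 * M) : ℕ) := by exact_mod_cast hNpos
  have hsum := Finset.sum_le_sum fun i (_ : i ∈ (Finset.univ : Finset (MatsubaraIdx (2 * M)))) =>
    norm_truncationSymbol_le hβ ξ M i
  rw [Finset.sum_const, Finset.card_univ, nsmul_eq_mul] at hsum
  have hcard : (Fintype.card (MatsubaraIdx (2 * M)) : ℝ) = (2 * (2 * M) : ℕ) := by
    rw [Fintype.card_fin]
  rw [hcard] at hsum
  calc 1 / β * _ ≤ 1 / β * (((2 * (2 * M) : ℕ) : ℝ) * (6 * (β / (2 * (2 * M) : ℕ)))) := by gcongr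
    _ = 6 := by field_simp

/-! ### (d) The truncated propagator on the grid: decomposition and the `M`-uniform determinant bound -/

/-- **The sharply truncated propagator on the `4M`-grid = the chronological kernel + a Gram kernel with `O(ε)` symbol.**
For grid indices `j, l < N = 2·(2M)` (`τ_j = jβ/N`, `ε = β/N`) and real `ξ`,
`β⁻¹ Σ_{i' ∈ MatsubaraIdx M} e^{-iν_{i'}(τ_j - τ_l)}/(-iν_{i'} + ξ)
   = ([l ≤ j] e^{(τ_j-τ_l)(-ξ)}(1+e^{β(-ξ)})⁻¹ - [j < l] e^{(τ_j-τ_l)(-ξ)}(1+e^{-β(-ξ)})⁻¹) + β⁻¹ Σ_{i ∈ MatsubaraIdx (2M)} e^{iν_i ε(l-j)} d_i(ξ)`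
(the first bracket in the normal form of `timeKernel_on_eq` / `timeKernel_off_eq` with energy `d = -ξ`).  Elementary, unprinted in
this form. [cite: Salmhofer1999, §4.2.4 (4.59)–(4.65)] -/
theorem truncatedPropagator_grid_eq {β : ℝ} (hβ : 0 < β) (ξ : ℝ) (M : ℕ) [NeZero M] (j l : Fin (2 * (2 * M))) :
    ((1 / β : ℝ) : ℂ) * ∑ i' : MatsubaraIdx M,
        Complex.exp (-((matsubaraFreq β M i' * (gridTime β (2 * (2 * M)) j - gridTime β (2 * (2 * M)) l) : ℝ) : ℂ) * I) /
          (-((matsubaraFreq β M i' : ℝ) : ℂ) * I + (ξ : ℂ)) =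
      (if (l : ℕ) ≤ (j : ℕ) then
          ((Real.exp ((gridTime β (2 * (2 * M)) j - gridTime β (2 * (2 * M)) l) * (-ξ)) *
              (1 + Real.exp (β * (-ξ)))⁻¹ : ℝ) : ℂ)
        else
          -((Real.exp ((gridTime β (2 * (2 * M)) j - gridTime β (2 * (2 * M)) l) * (-ξ)) *
              (1 + Real.exp (-(β * (-ξ))))⁻¹ : ℝ) : ℂ)) +
        ((1 / β : ℝ) : ℂ) * ∑ i : MatsubaraIdx (2 * M),
          Complex.exp (((matsubaraFreq β (2 * M) i * (β / (2 * (2 * M) : ℕ)) *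
              ((((l : ℕ) : ℤ) - ((j : ℕ) : ℤ) : ℤ) : ℝ) : ℝ) : ℂ) * I) *
            ((if M ≤ (i : ℕ) ∧ (i : ℕ) < 3 * M then
                (1 : ℂ) / (-((matsubaraFreq β (2 * M) i : ℝ) : ℂ) * I + (ξ : ℂ)) else 0) -
              ((β / (2 * (2 * M) : ℕ) : ℝ) : ℂ) /
                (1 - Complex.exp ((((matsubaraFreq β (2 * M) i : ℝ) : ℂ) * I - (ξ : ℂ)) *
                  ((β / (2 * (2 * M) : ℕ) : ℝ) : ℂ)))) := by
  have hNpos : 0 < 2 * (2 * M) := by have := NeZero.pos M; omega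
  have hNr : ((2 * (2 * M) : ℕ) : ℝ) ≠ 0 := by exact_mod_cast hNpos.ne'
  -- the time difference is `ε (j - l)`
  have hτ : gridTime β (2 * (2 * M)) j - gridTime β (2 * (2 * M)) l =
      β / (2 * (2 * M) : ℕ) * (((j : ℕ) : ℝ) - ((l : ℕ) : ℝ)) := by
    simp only [gridTime]
    field_simp
  -- step 1: reindex the kept frequencies inside `MatsubaraIdx (2M)`
  rw [sum_matsubaraIdx_eq_sum_ite M β (fun x => Complex.exp (-((x *
      (gridTime β (2 * (2 * M)) j - gridTime β (2 * (2 * M)) l) : ℝ) : ℂ) * I) / (-((x : ℝ) : ℂ) * I + (ξ : ℂ)))]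
  -- step 2: termwise, `[kept]·e/A = e·ε/(1-z) + e·d`
  have h2 : ∀ i : MatsubaraIdx (2 * M),
      (if M ≤ (i : ℕ) ∧ (i : ℕ) < 3 * M then
          Complex.exp (-((matsubaraFreq β (2 * M) i *
              (gridTime β (2 * (2 * M)) j - gridTime β (2 * (2 * M)) l) : ℝ) : ℂ) * I) /
            (-((matsubaraFreq β (2 * M) i : ℝ) : ℂ) * I + (ξ : ℂ)) else 0) =
        Complex.exp (((matsubaraFreq β (2 * M) i * (β / (2 * (2 * M) : ℕ)) *
              ((((l : ℕ) : ℤ) - ((j : ℕ) : ℤ) : ℤ) : ℝ) : ℝ) : ℂ) * I) *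
            (((β / (2 * (2 * M) : ℕ) : ℝ) : ℂ) /
              (1 - Complex.exp ((((matsubaraFreq β (2 * M) i : ℝ) : ℂ) * I - (ξ : ℂ)) *
                ((β / (2 * (2 * M) : ℕ) : ℝ) : ℂ)))) +
          Complex.exp (((matsubaraFreq β (2 * M) i * (β / (2 * (2 * M) : ℕ)) *
              ((((l : ℕ) : ℤ) - ((j : ℕ) : ℤ) : ℤ) : ℝ) : ℝ) : ℂ) * I) *
            ((if M ≤ (i : ℕ) ∧ (i : ℕ) < 3 * M then
                (1 : ℂ) / (-((matsubaraFreq β (2 * M) i : ℝ) : ℂ) * I + (ξ : ℂ)) else 0) -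
              ((β / (2 * (2 * M) : ℕ) : ℝ) : ℂ) /
                (1 - Complex.exp ((((matsubaraFreq β (2 * M) i : ℝ) : ℂ) * I - (ξ : ℂ)) *
                  ((β / (2 * (2 * M) : ℕ) : ℝ) : ℂ)))) := by
    intro i
    have hexp : Complex.exp (-((matsubaraFreq β (2 * M) i *
          (gridTime β (2 * (2 * M)) j - gridTime β (2 * (2 * M)) l) : ℝ) : ℂ) * I) =
        Complex.exp (((matsubaraFreq β (2 * M) i * (β / (2 * (2 * M) : ℕ)) *
          ((((l : ℕ) : ℤ) - ((j : ℕ) : ℤ) : ℤ) : ℝ) : ℝ) : ℂ) * I) := by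
      congr 1
      rw [hτ]
      push_cast
      ring
    split_ifs with hi
    · rw [hexp]; ring
    · ring
  rw [Finset.sum_congr rfl (fun i _ => h2 i), Finset.sum_add_distrib, mul_add]
  congr 1
  -- step 3: the first sum is the chronological kernel, by `gridKernel_fourier_int`
  rw [gridKernel_fourier_int hβ ξ M j.isLt l.isLt]
  have hΔ : -(β / (2 * (2 * M) : ℕ) * (((j : ℕ) : ℝ) - ((l : ℕ) : ℝ)) * ξ) =
      (gridTime β (2 * (2 * M)) j - gridTime β (2 * (2 * M)) l) * (-ξ) := by
    rw [hτ]; ring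
  split_ifs with hlj
  · congr 1
    rw [div_eq_mul_inv, hΔ, mul_neg β ξ]
  · congr 2
    rw [div_eq_mul_inv, hΔ, mul_neg β ξ, neg_neg]


/-- **The `M`-uniform determinant bound for the sharply truncated propagator on the `4M`-grid — mode form**
(de Siqueira Pedra–Salmhofer 2008, Thm 1.3 with the Gram data of Lemma 4.1, applied to the decomposition
`truncatedPropagator_grid_eq`).  One-body modes `m` with real energies `ξ_m`, `β > 0`, `M ≥ 1`, creation data
(`F_a`, grid time index `j_a < N = 2·(2M)`), annihilation data (`G_b`, grid time index `l_b`); the matrix of sharply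
truncated free propagators `Σ_m F_a(m) G_b(m) · β⁻¹ Σ_{i' ∈ MatsubaraIdx M} e^{-iν_{i'}(τ_{j_a} - τ_{l_b})}/(-iν_{i'} + ξ_m)`
satisfies `|det| ≤ 14ⁿ ∏_a ‖F_a‖₂ ∏_b ‖G_b‖₂` — UNIFORMLY in `M`, `β`, the energies and the number of modes.  Proof: by
`truncatedPropagator_grid_eq` each entry is the chronological kernel (`[l_b ≤ j_a]`-pattern) of the time kernels
`e^{(s-t)d}(1+e^{±βd})⁻¹`, `d = -ξ_m`, realised as in `norm_det_timeOrdered_modes_le` by weights `≤ 1` and unit Gram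
vectors of `e^{-|d||z-z'|}` (`timeKernel_on_eq`, `timeKernel_off_eq`, `isPosDefKernel_exp_neg_mul_abs_sub`), PLUS the
Gram kernel `β⁻¹ Σ_i e^{iν_i ε(l_b - j_a)} d_i(ξ_m)` realised by `(F_a(m) e^{-iν_i ε j_a} d_i(ξ_m) t, G_b(m) e^{iν_i ε l_b} √T/β)`,
`T = 6Nε²`, `t = 1/√T`, appended to BOTH branches; by `norm_truncationSymbol_le` all four coordinate families have squared
norms `≤ (1 + 6) Σ_m |F_a(m)|²` resp. `(1 + 6) Σ_m |G_b(m)|²`, and `norm_det_chronological_le_of_times'` gives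
`∏_a √(14 ‖F_a‖²) ∏_b √(14 ‖G_b‖²)`. [cite: PedraSalmhofer2008, Thm 1.3 and Lemma 4.1] -/
theorem norm_det_truncatedPropagator_grid_le {μ : Type*} [Fintype μ] (ξ : μ → ℝ) {β : ℝ} (hβ : 0 < β)
    (M : ℕ) [NeZero M] {n : ℕ} (F G : Fin n → μ → ℂ) (j l : Fin n → Fin (2 * (2 * M))) :
    ‖(Matrix.of fun a b : Fin n =>
        ∑ m, F a m * G b m *
          (((1 / β : ℝ) : ℂ) * ∑ i' : MatsubaraIdx M,
            Complex.exp (-((matsubaraFreq β M i' *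
                (gridTime β (2 * (2 * M)) (j a) - gridTime β (2 * (2 * M)) (l b)) : ℝ) : ℂ) * I) /
              (-((matsubaraFreq β M i' : ℝ) : ℂ) * I + (ξ m : ℂ)))).det‖ ≤
      14 ^ n * ((∏ a, Real.sqrt (∑ m, ‖F a m‖ ^ 2)) * ∏ b, Real.sqrt (∑ m, ‖G b m‖ ^ 2)) := by
  classical
  have hNpos : 0 < 2 * (2 * M) := by have := NeZero.pos M; omega
  have hNr : (0 : ℝ) < ((2 * (2 * M) : ℕ) : ℝ) := by exact_mod_cast hNpos
  have hNne : ((2 * (2 * M) : ℕ) : ℝ) ≠ 0 := hNr.ne'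
  have hε0 : 0 < β / (2 * (2 * M) : ℕ) := by positivity
  have hεne : β / (2 * (2 * M) : ℕ) ≠ 0 := hε0.ne'
  have hεN : β / (2 * (2 * M) : ℕ) * ((2 * (2 * M) : ℕ) : ℝ) = β := by field_simp
  -- grid times: `τ_c = ε c ∈ [0, β]`, ordered like the indices
  have hgt : ∀ c : Fin (2 * (2 * M)), gridTime β (2 * (2 * M)) c = β / (2 * (2 * M) : ℕ) * ((c : ℕ) : ℝ) := by
    intro c
    simp only [gridTime]
    ring
  have hgt0 : ∀ c : Fin (2 * (2 * M)), 0 ≤ gridTime β (2 * (2 * M)) c := fun c => by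
    rw [hgt]; positivity
  have hgtβ : ∀ c : Fin (2 * (2 * M)), gridTime β (2 * (2 * M)) c ≤ β := by
    intro c
    rw [hgt]
    have hc : ((c : ℕ) : ℝ) ≤ ((2 * (2 * M) : ℕ) : ℝ) := by exact_mod_cast c.isLt.le
    calc β / (2 * (2 * M) : ℕ) * ((c : ℕ) : ℝ) ≤ β / (2 * (2 * M) : ℕ) * ((2 * (2 * M) : ℕ) : ℝ) :=
          mul_le_mul_of_nonneg_left hc hε0.le
      _ = β := hεN
  have hmono : ∀ c c' : Fin (2 * (2 * M)), (c : ℕ) ≤ (c' : ℕ) →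
      gridTime β (2 * (2 * M)) c ≤ gridTime β (2 * (2 * M)) c' := by
    intro c c' h
    rw [hgt, hgt]
    exact mul_le_mul_of_nonneg_left (by exact_mod_cast h) hε0.le
  -- the remainder symbol `d_i(ξ_m)` and the phases `e^{-iν_i ε j_a}`, `e^{iν_i ε l_b}`
  set D : μ → MatsubaraIdx (2 * M) → ℂ := fun m i =>
    (if M ≤ (i : ℕ) ∧ (i : ℕ) < 3 * M then
        (1 : ℂ) / (-((matsubaraFreq β (2 * M) i : ℝ) : ℂ) * I + (ξ m : ℂ)) else 0) -
      ((β / (2 * (2 * M) : ℕ) : ℝ) : ℂ) /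
        (1 - Complex.exp ((((matsubaraFreq β (2 * M) i : ℝ) : ℂ) * I - (ξ m : ℂ)) *
          ((β / (2 * (2 * M) : ℕ) : ℝ) : ℂ))) with hD
  have hDle : ∀ m i, ‖D m i‖ ≤ 6 * (β / (2 * (2 * M) : ℕ)) := fun m i => by
    simp only [hD]
    exact norm_truncationSymbol_le hβ (ξ m) M i
  set eJ : Fin n → MatsubaraIdx (2 * M) → ℂ := fun a i =>
    Complex.exp (-(((matsubaraFreq β (2 * M) i * (β / (2 * (2 * M) : ℕ)) * ((j a : ℕ) : ℝ)) : ℝ) : ℂ) * I)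
    with heJ
  set eL : Fin n → MatsubaraIdx (2 * M) → ℂ := fun b i =>
    Complex.exp ((((matsubaraFreq β (2 * M) i * (β / (2 * (2 * M) : ℕ)) * ((l b : ℕ) : ℝ)) : ℝ) : ℂ) * I)
    with heL
  have hneJ : ∀ a i, ‖eJ a i‖ = 1 := fun a i => by
    simp only [heJ]
    rw [← Complex.ofReal_neg, Complex.norm_exp_ofReal_mul_I]
  have hneL : ∀ b i, ‖eL b i‖ = 1 := fun b i => by
    simp only [heL]
    rw [Complex.norm_exp_ofReal_mul_I]
  have hphase : ∀ a b i, eJ a i * eL b i =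
      Complex.exp (((matsubaraFreq β (2 * M) i * (β / (2 * (2 * M) : ℕ)) *
        ((((l b : ℕ) : ℤ) - ((j a : ℕ) : ℤ) : ℤ) : ℝ) : ℝ) : ℂ) * I) := by
    intro a b i
    simp only [heJ, heL]
    rw [← Complex.exp_add]
    congr 1
    push_cast
    ring
  -- the global scale of the remainder block: `T = 6 N ε²`, `t = 1/√T`
  set T : ℝ := 6 * ((2 * (2 * M) : ℕ) : ℝ) * (β / (2 * (2 * M) : ℕ)) ^ 2 with hT
  have hT0 : 0 < T := by positivity
  have hsT : 0 < Real.sqrt T := Real.sqrt_pos.2 hT0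
  have hsTne : Real.sqrt T ≠ 0 := hsT.ne'
  set tR : ℝ := (Real.sqrt T)⁻¹ with htR
  have htR0 : 0 < tR := by positivity
  have htR2 : tR ^ 2 = T⁻¹ := by rw [htR, inv_pow, Real.sq_sqrt hT0.le]
  have hcβ : 0 ≤ Real.sqrt T / β := by positivity
  have htc : ((tR : ℝ) : ℂ) * (((Real.sqrt T / β) : ℝ) : ℂ) = ((1 / β : ℝ) : ℂ) := by
    rw [← Complex.ofReal_mul]
    congr 1
    rw [htR]
    field_simp
  have hRrow : ((2 * (2 * M) : ℕ) : ℝ) * ((6 * (β / (2 * (2 * M) : ℕ))) ^ 2 * tR ^ 2) = 6 := by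
    rw [htR2, hT]
    field_simp
  have hRcol : ((2 * (2 * M) : ℕ) : ℝ) * ((Real.sqrt T / β) ^ 2) = 6 := by
    rw [div_pow, Real.sq_sqrt hT0.le, hT]
    field_simp
  have hcardR : (Fintype.card (MatsubaraIdx (2 * M)) : ℝ) = ((2 * (2 * M) : ℕ) : ℝ) := by
    rw [Fintype.card_fin]
  -- the entries: `c_M = K + R` (`truncatedPropagator_grid_eq`), `R` in terms of the phases and `D`
  have hentry : ∀ a b : Fin n,
      ∑ m, F a m * G b m *
          (((1 / β : ℝ) : ℂ) * ∑ i' : MatsubaraIdx M,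
            Complex.exp (-((matsubaraFreq β M i' *
                (gridTime β (2 * (2 * M)) (j a) - gridTime β (2 * (2 * M)) (l b)) : ℝ) : ℂ) * I) /
              (-((matsubaraFreq β M i' : ℝ) : ℂ) * I + (ξ m : ℂ))) =
        (if (l b : ℕ) ≤ (j a : ℕ) then
            ∑ m, F a m * G b m *
              ((Real.exp ((gridTime β (2 * (2 * M)) (j a) - gridTime β (2 * (2 * M)) (l b)) * (-ξ m)) *
                (1 + Real.exp (β * (-ξ m)))⁻¹ : ℝ) : ℂ)
          else
            -∑ m, F a m * G b m *
              ((Real.exp ((gridTime β (2 * (2 * M)) (j a) - gridTime β (2 * (2 * M)) (l b)) * (-ξ m)) *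
                (1 + Real.exp (-(β * (-ξ m))))⁻¹ : ℝ) : ℂ)) +
          ∑ m, F a m * G b m *
            (((1 / β : ℝ) : ℂ) * ∑ i : MatsubaraIdx (2 * M), eJ a i * eL b i * D m i) := by
    intro a b
    have hm : ∀ m : μ,
        ((1 / β : ℝ) : ℂ) * ∑ i' : MatsubaraIdx M,
            Complex.exp (-((matsubaraFreq β M i' *
                (gridTime β (2 * (2 * M)) (j a) - gridTime β (2 * (2 * M)) (l b)) : ℝ) : ℂ) * I) /
              (-((matsubaraFreq β M i' : ℝ) : ℂ) * I + (ξ m : ℂ)) =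
          (if (l b : ℕ) ≤ (j a : ℕ) then
              ((Real.exp ((gridTime β (2 * (2 * M)) (j a) - gridTime β (2 * (2 * M)) (l b)) * (-ξ m)) *
                  (1 + Real.exp (β * (-ξ m)))⁻¹ : ℝ) : ℂ)
            else
              -((Real.exp ((gridTime β (2 * (2 * M)) (j a) - gridTime β (2 * (2 * M)) (l b)) * (-ξ m)) *
                  (1 + Real.exp (-(β * (-ξ m))))⁻¹ : ℝ) : ℂ)) +
            ((1 / β : ℝ) : ℂ) * ∑ i : MatsubaraIdx (2 * M), eJ a i * eL b i * D m i := by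
      intro m
      rw [truncatedPropagator_grid_eq hβ (ξ m) M (j a) (l b)]
      congr 1
      congr 1
      refine Finset.sum_congr rfl fun i _ => ?_
      rw [hphase a b i]
    simp_rw [hm]
    split_ifs with hab
    · rw [← Finset.sum_add_distrib]
      exact Finset.sum_congr rfl fun m _ => by ring
    · rw [← Finset.sum_neg_distrib, ← Finset.sum_add_distrib]
      exact Finset.sum_congr rfl fun m _ => by ring
  -- K-block data, verbatim as in `norm_det_timeOrdered_modes_le` with `d = -ξ`, `s_a = τ_{j_a}`, `t_b = τ_{l_b}`
  set w : μ → ℝ := fun m => (1 + Real.exp (-(β * |-ξ m|)))⁻¹ with hw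
  have hw0 : ∀ m, 0 ≤ w m := fun m => by positivity
  have hw1 : ∀ m, w m ≤ 1 := fun m => by
    simp only [hw]
    apply inv_le_one_of_one_le₀
    linarith [Real.exp_pos (-(β * |-ξ m|))]
  have hsqw : ∀ m, ((Real.sqrt (w m) : ℝ) : ℂ) * (Real.sqrt (w m) : ℂ) = (w m : ℂ) := fun m => by
    rw [← Complex.ofReal_mul, Real.mul_self_sqrt (hw0 m)]
  set z₁ : μ → (Fin n ⊕ Fin n) → ℝ := fun m =>
    Sum.elim (fun a => gridTime β (2 * (2 * M)) (j a) - if 0 < -ξ m then β else 0)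
      (fun b => gridTime β (2 * (2 * M)) (l b)) with hz₁
  set z₂ : μ → (Fin n ⊕ Fin n) → ℝ := fun m =>
    Sum.elim (fun a => gridTime β (2 * (2 * M)) (j a))
      (fun b => gridTime β (2 * (2 * M)) (l b) - if -ξ m < 0 then β else 0) with hz₂
  have hV : ∀ (m : μ) (z : (Fin n ⊕ Fin n) → ℝ), ∃ V : (Fin n ⊕ Fin n) → (Fin n ⊕ Fin n) → ℂ,
      (∀ a b, ∑ r, star (V a r) * V b r = (Real.exp (-(|-ξ m| * |z a - z b|)) : ℂ)) ∧
        ∀ a, ∑ r, ‖V a r‖ ^ 2 = 1 := fun m z =>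
    (isPosDefKernel_exp_neg_mul_abs_sub (abs_nonneg (-ξ m))).exists_gram_vectors
      (fun y => by simp) z
  choose V₁ hV₁ hV₁n using fun m => hV m (z₁ m)
  choose V₂ hV₂ hV₂n using fun m => hV m (z₂ m)
  -- coordinates: K-block and R-block families, and their concatenations
  set uK : Fin n → (μ × (Fin n ⊕ Fin n)) → ℂ :=
    fun a x => F a x.1 * (Real.sqrt (w x.1) : ℂ) * star (V₁ x.1 (Sum.inl a) x.2) with huK
  set vK : Fin n → (μ × (Fin n ⊕ Fin n)) → ℂ :=
    fun b x => G b x.1 * (Real.sqrt (w x.1) : ℂ) * V₁ x.1 (Sum.inr b) x.2 with hvK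
  set pK : Fin n → (μ × (Fin n ⊕ Fin n)) → ℂ :=
    fun a x => F a x.1 * (Real.sqrt (w x.1) : ℂ) * star (V₂ x.1 (Sum.inl a) x.2) with hpK
  set qK : Fin n → (μ × (Fin n ⊕ Fin n)) → ℂ :=
    fun b x => -(G b x.1 * (Real.sqrt (w x.1) : ℂ) * V₂ x.1 (Sum.inr b) x.2) with hqK
  set uR : Fin n → (μ × MatsubaraIdx (2 * M)) → ℂ :=
    fun a y => F a y.1 * eJ a y.2 * D y.1 y.2 * (tR : ℂ) with huR
  set vR : Fin n → (μ × MatsubaraIdx (2 * M)) → ℂ :=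
    fun b y => G b y.1 * eL b y.2 * (((Real.sqrt T / β) : ℝ) : ℂ) with hvR
  set u : Fin n → ((μ × (Fin n ⊕ Fin n)) ⊕ (μ × MatsubaraIdx (2 * M))) → ℂ :=
    fun a => Sum.elim (uK a) (uR a) with hu
  set v : Fin n → ((μ × (Fin n ⊕ Fin n)) ⊕ (μ × MatsubaraIdx (2 * M))) → ℂ :=
    fun b => Sum.elim (vK b) (vR b) with hv
  set p : Fin n → ((μ × (Fin n ⊕ Fin n)) ⊕ (μ × MatsubaraIdx (2 * M))) → ℂ :=
    fun a => Sum.elim (pK a) (uR a) with hp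
  set q : Fin n → ((μ × (Fin n ⊕ Fin n)) ⊕ (μ × MatsubaraIdx (2 * M))) → ℂ :=
    fun b => Sum.elim (qK b) (vR b) with hq
  have hsplit_uv : ∀ a b, ∑ x, u a x * v b x = ∑ x, uK a x * vK b x + ∑ y, uR a y * vR b y := by
    intro a b
    simp only [hu, hv, Fintype.sum_sum_type, Sum.elim_inl, Sum.elim_inr]
  have hsplit_pq : ∀ a b, ∑ x, p a x * q b x = ∑ x, pK a x * qK b x + ∑ y, uR a y * vR b y := by
    intro a b
    simp only [hp, hq, Fintype.sum_sum_type, Sum.elim_inl, Sum.elim_inr]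
  -- the R-block realises `Σ_m F_a(m) G_b(m) β⁻¹ Σ_i e^{iν_i ε(l_b - j_a)} d_i(ξ_m)`
  have hR : ∀ a b : Fin n, ∑ y, uR a y * vR b y =
      ∑ m, F a m * G b m * (((1 / β : ℝ) : ℂ) * ∑ i : MatsubaraIdx (2 * M), eJ a i * eL b i * D m i) := by
    intro a b
    rw [Fintype.sum_prod_type]
    refine Finset.sum_congr rfl fun m _ => ?_
    rw [Finset.mul_sum, Finset.mul_sum]
    refine Finset.sum_congr rfl fun i _ => ?_
    simp only [huR, hvR]
    rw [← htc]
    ring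
  -- the K-block realises the chronological kernel (Pedra–Salmhofer Lemma 4.1)
  have honK : ∀ a b : Fin n, (l b : ℕ) ≤ (j a : ℕ) → ∑ x, uK a x * vK b x =
      ∑ m, F a m * G b m *
        ((Real.exp ((gridTime β (2 * (2 * M)) (j a) - gridTime β (2 * (2 * M)) (l b)) * (-ξ m)) *
          (1 + Real.exp (β * (-ξ m)))⁻¹ : ℝ) : ℂ) := by
    intro a b hab
    have htsa : gridTime β (2 * (2 * M)) (l b) ≤ gridTime β (2 * (2 * M)) (j a) := hmono _ _ hab
    rw [Fintype.sum_prod_type]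
    refine Finset.sum_congr rfl fun m _ => ?_
    have e1 : ∀ r, uK a (m, r) * vK b (m, r) = F a m * G b m * (w m : ℂ) *
        (star (V₁ m (Sum.inl a) r) * V₁ m (Sum.inr b) r) := by
      intro r
      simp only [huK, hvK]
      rw [← hsqw m]
      ring
    simp_rw [e1]
    rw [← Finset.mul_sum, hV₁ m, timeKernel_on_eq (-ξ m) β _ _ htsa (hgtβ _) (hgt0 _)]
    simp only [hz₁, Sum.elim_inl, Sum.elim_inr, hw]
    push_cast
    ring_nf
  have hoffK : ∀ a b : Fin n, ¬ (l b : ℕ) ≤ (j a : ℕ) → ∑ x, pK a x * qK b x =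
      -∑ m, F a m * G b m *
        ((Real.exp ((gridTime β (2 * (2 * M)) (j a) - gridTime β (2 * (2 * M)) (l b)) * (-ξ m)) *
          (1 + Real.exp (-(β * (-ξ m))))⁻¹ : ℝ) : ℂ) := by
    intro a b hab
    have hsat : gridTime β (2 * (2 * M)) (j a) ≤ gridTime β (2 * (2 * M)) (l b) :=
      hmono _ _ (Nat.le_of_lt (Nat.lt_of_not_le hab))
    rw [Fintype.sum_prod_type, ← Finset.sum_neg_distrib]
    refine Finset.sum_congr rfl fun m _ => ?_
    have e1 : ∀ r, pK a (m, r) * qK b (m, r) = -(F a m * G b m * (w m : ℂ) *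
        (star (V₂ m (Sum.inl a) r) * V₂ m (Sum.inr b) r)) := by
      intro r
      simp only [hpK, hqK]
      rw [← hsqw m]
      ring
    simp_rw [e1]
    rw [Finset.sum_neg_distrib, ← Finset.mul_sum, hV₂ m,
      timeKernel_off_eq (-ξ m) β _ _ hsat (hgt0 _) (hgtβ _)]
    simp only [hz₂, Sum.elim_inl, Sum.elim_inr, hw]
    push_cast
    ring_nf
  -- the realisation as a chronological product
  have hM : (Matrix.of fun a b : Fin n =>
        ∑ m, F a m * G b m *
          (((1 / β : ℝ) : ℂ) * ∑ i' : MatsubaraIdx M,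
            Complex.exp (-((matsubaraFreq β M i' *
                (gridTime β (2 * (2 * M)) (j a) - gridTime β (2 * (2 * M)) (l b)) : ℝ) : ℂ) * I) /
              (-((matsubaraFreq β M i' : ℝ) : ℂ) * I + (ξ m : ℂ)))) =
      Matrix.of fun a b : Fin n =>
        if (l b : ℕ) ≤ (j a : ℕ) then ∑ x, u a x * v b x else ∑ x, p a x * q b x := by
    ext a b
    simp only [Matrix.of_apply]
    rw [hentry a b]
    split_ifs with hab
    · rw [hsplit_uv, honK a b hab, hR]
    · rw [hsplit_pq, hoffK a b hab, hR]
  rw [hM]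
  refine (norm_det_chronological_le_of_times' (J := ℕ) (fun a => (j a : ℕ)) (fun b => (l b : ℕ)) u v p q).trans ?_
  -- norms: K-blocks `≤ Σ_m |F_a(m)|²`, R-blocks `≤ 6 Σ_m |F_a(m)|²`
  have hnuK : ∀ a, ∑ x, ‖uK a x‖ ^ 2 ≤ ∑ m, ‖F a m‖ ^ 2 := by
    intro a
    rw [Fintype.sum_prod_type]
    refine Finset.sum_le_sum fun m _ => ?_
    have e1 : ∀ r, ‖uK a (m, r)‖ ^ 2 = ‖F a m‖ ^ 2 * w m * ‖V₁ m (Sum.inl a) r‖ ^ 2 := by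
      intro r
      simp only [huK, norm_mul, norm_star, Complex.norm_real, Real.norm_eq_abs,
        abs_of_nonneg (Real.sqrt_nonneg _), mul_pow, Real.sq_sqrt (hw0 m)]
    simp_rw [e1]
    rw [← Finset.mul_sum, hV₁n m, mul_one]
    exact mul_le_of_le_one_right (by positivity) (hw1 m)
  have hnpK : ∀ a, ∑ x, ‖pK a x‖ ^ 2 ≤ ∑ m, ‖F a m‖ ^ 2 := by
    intro a
    rw [Fintype.sum_prod_type]
    refine Finset.sum_le_sum fun m _ => ?_
    have e1 : ∀ r, ‖pK a (m, r)‖ ^ 2 = ‖F a m‖ ^ 2 * w m * ‖V₂ m (Sum.inl a) r‖ ^ 2 := by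
      intro r
      simp only [hpK, norm_mul, norm_star, Complex.norm_real, Real.norm_eq_abs,
        abs_of_nonneg (Real.sqrt_nonneg _), mul_pow, Real.sq_sqrt (hw0 m)]
    simp_rw [e1]
    rw [← Finset.mul_sum, hV₂n m, mul_one]
    exact mul_le_of_le_one_right (by positivity) (hw1 m)
  have hnvK : ∀ b, ∑ x, ‖vK b x‖ ^ 2 ≤ ∑ m, ‖G b m‖ ^ 2 := by
    intro b
    rw [Fintype.sum_prod_type]
    refine Finset.sum_le_sum fun m _ => ?_
    have e1 : ∀ r, ‖vK b (m, r)‖ ^ 2 = ‖G b m‖ ^ 2 * w m * ‖V₁ m (Sum.inr b) r‖ ^ 2 := by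
      intro r
      simp only [hvK, norm_mul, Complex.norm_real, Real.norm_eq_abs,
        abs_of_nonneg (Real.sqrt_nonneg _), mul_pow, Real.sq_sqrt (hw0 m)]
    simp_rw [e1]
    rw [← Finset.mul_sum, hV₁n m, mul_one]
    exact mul_le_of_le_one_right (by positivity) (hw1 m)
  have hnqK : ∀ b, ∑ x, ‖qK b x‖ ^ 2 ≤ ∑ m, ‖G b m‖ ^ 2 := by
    intro b
    rw [Fintype.sum_prod_type]
    refine Finset.sum_le_sum fun m _ => ?_
    have e1 : ∀ r, ‖qK b (m, r)‖ ^ 2 = ‖G b m‖ ^ 2 * w m * ‖V₂ m (Sum.inr b) r‖ ^ 2 := by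
      intro r
      simp only [hqK, norm_neg, norm_mul, Complex.norm_real, Real.norm_eq_abs,
        abs_of_nonneg (Real.sqrt_nonneg _), mul_pow, Real.sq_sqrt (hw0 m)]
    simp_rw [e1]
    rw [← Finset.mul_sum, hV₂n m, mul_one]
    exact mul_le_of_le_one_right (by positivity) (hw1 m)
  have hnuR : ∀ a, ∑ y, ‖uR a y‖ ^ 2 ≤ 6 * ∑ m, ‖F a m‖ ^ 2 := by
    intro a
    rw [Fintype.sum_prod_type, Finset.mul_sum]
    refine Finset.sum_le_sum fun m _ => ?_
    have e1 : ∀ i, ‖uR a (m, i)‖ ^ 2 = ‖F a m‖ ^ 2 * (‖D m i‖ ^ 2 * tR ^ 2) := by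
      intro i
      simp only [huR, norm_mul, Complex.norm_real, Real.norm_of_nonneg htR0.le]
      rw [hneJ]
      ring
    simp_rw [e1]
    rw [← Finset.mul_sum]
    have hsum : ∑ i : MatsubaraIdx (2 * M), ‖D m i‖ ^ 2 * tR ^ 2 ≤ 6 := by
      calc ∑ i : MatsubaraIdx (2 * M), ‖D m i‖ ^ 2 * tR ^ 2
          ≤ ∑ _i : MatsubaraIdx (2 * M), (6 * (β / (2 * (2 * M) : ℕ))) ^ 2 * tR ^ 2 := by
            refine Finset.sum_le_sum fun i _ => ?_
            have h1 : ‖D m i‖ ^ 2 ≤ (6 * (β / (2 * (2 * M) : ℕ))) ^ 2 :=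
              pow_le_pow_left₀ (norm_nonneg _) (hDle m i) 2
            exact mul_le_mul_of_nonneg_right h1 (sq_nonneg _)
        _ = 6 := by
            rw [Finset.sum_const, Finset.card_univ, nsmul_eq_mul, hcardR]
            exact hRrow
    calc ‖F a m‖ ^ 2 * ∑ i : MatsubaraIdx (2 * M), ‖D m i‖ ^ 2 * tR ^ 2 ≤ ‖F a m‖ ^ 2 * 6 :=
          mul_le_mul_of_nonneg_left hsum (sq_nonneg _)
      _ = 6 * ‖F a m‖ ^ 2 := by ring
  have hnvR : ∀ b, ∑ y, ‖vR b y‖ ^ 2 ≤ 6 * ∑ m, ‖G b m‖ ^ 2 := by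
    intro b
    rw [Fintype.sum_prod_type, Finset.mul_sum]
    refine Finset.sum_le_sum fun m _ => ?_
    have e1 : ∀ i, ‖vR b (m, i)‖ ^ 2 = ‖G b m‖ ^ 2 * (Real.sqrt T / β) ^ 2 := by
      intro i
      simp only [hvR, norm_mul, Complex.norm_real, Real.norm_of_nonneg hcβ]
      rw [hneL]
      ring
    simp_rw [e1]
    rw [Finset.sum_const, Finset.card_univ, nsmul_eq_mul, hcardR]
    calc ((2 * (2 * M) : ℕ) : ℝ) * (‖G b m‖ ^ 2 * (Real.sqrt T / β) ^ 2)
        = (((2 * (2 * M) : ℕ) : ℝ) * (Real.sqrt T / β) ^ 2) * ‖G b m‖ ^ 2 := by ring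
      _ = 6 * ‖G b m‖ ^ 2 := by rw [hRcol]
      _ ≤ 6 * ‖G b m‖ ^ 2 := le_rfl
  have hnu : ∀ a, ∑ x, ‖u a x‖ ^ 2 ≤ 7 * ∑ m, ‖F a m‖ ^ 2 := by
    intro a
    have : ∑ x, ‖u a x‖ ^ 2 = ∑ x, ‖uK a x‖ ^ 2 + ∑ y, ‖uR a y‖ ^ 2 := by
      simp only [hu, Fintype.sum_sum_type, Sum.elim_inl, Sum.elim_inr]
    rw [this]
    linarith [hnuK a, hnuR a]
  have hnp : ∀ a, ∑ x, ‖p a x‖ ^ 2 ≤ 7 * ∑ m, ‖F a m‖ ^ 2 := by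
    intro a
    have : ∑ x, ‖p a x‖ ^ 2 = ∑ x, ‖pK a x‖ ^ 2 + ∑ y, ‖uR a y‖ ^ 2 := by
      simp only [hp, Fintype.sum_sum_type, Sum.elim_inl, Sum.elim_inr]
    rw [this]
    linarith [hnpK a, hnuR a]
  have hnv : ∀ b, ∑ x, ‖v b x‖ ^ 2 ≤ 7 * ∑ m, ‖G b m‖ ^ 2 := by
    intro b
    have : ∑ x, ‖v b x‖ ^ 2 = ∑ x, ‖vK b x‖ ^ 2 + ∑ y, ‖vR b y‖ ^ 2 := by
      simp only [hv, Fintype.sum_sum_type, Sum.elim_inl, Sum.elim_inr]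
    rw [this]
    linarith [hnvK b, hnvR b]
  have hnq : ∀ b, ∑ x, ‖q b x‖ ^ 2 ≤ 7 * ∑ m, ‖G b m‖ ^ 2 := by
    intro b
    have : ∑ x, ‖q b x‖ ^ 2 = ∑ x, ‖qK b x‖ ^ 2 + ∑ y, ‖vR b y‖ ^ 2 := by
      simp only [hq, Fintype.sum_sum_type, Sum.elim_inl, Sum.elim_inr]
    rw [this]
    linarith [hnqK b, hnvR b]
  -- assemble: `∏ √(‖u‖²+‖p‖²) ≤ (√14)ⁿ ∏ ‖F_a‖`, same for columns
  have hrow : (∏ a, Real.sqrt (∑ x, ‖u a x‖ ^ 2 + ∑ x, ‖p a x‖ ^ 2)) ≤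
      (Real.sqrt 14) ^ n * ∏ a, Real.sqrt (∑ m, ‖F a m‖ ^ 2) := by
    have : (Real.sqrt 14) ^ n * ∏ a, Real.sqrt (∑ m, ‖F a m‖ ^ 2) =
        ∏ a : Fin n, (Real.sqrt 14 * Real.sqrt (∑ m, ‖F a m‖ ^ 2)) := by
      rw [Finset.prod_mul_distrib, Finset.prod_const, Finset.card_univ, Fintype.card_fin]
    rw [this]
    refine Finset.prod_le_prod (fun a _ => Real.sqrt_nonneg _) fun a _ => ?_
    rw [← Real.sqrt_mul (by norm_num : (0 : ℝ) ≤ 14)]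
    exact Real.sqrt_le_sqrt (by linarith [hnu a, hnp a])
  have hcol : (∏ b, Real.sqrt (∑ x, ‖v b x‖ ^ 2 + ∑ x, ‖q b x‖ ^ 2)) ≤
      (Real.sqrt 14) ^ n * ∏ b, Real.sqrt (∑ m, ‖G b m‖ ^ 2) := by
    have : (Real.sqrt 14) ^ n * ∏ b, Real.sqrt (∑ m, ‖G b m‖ ^ 2) =
        ∏ b : Fin n, (Real.sqrt 14 * Real.sqrt (∑ m, ‖G b m‖ ^ 2)) := by
      rw [Finset.prod_mul_distrib, Finset.prod_const, Finset.card_univ, Fintype.card_fin]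
    rw [this]
    refine Finset.prod_le_prod (fun b _ => Real.sqrt_nonneg _) fun b _ => ?_
    rw [← Real.sqrt_mul (by norm_num : (0 : ℝ) ≤ 14)]
    exact Real.sqrt_le_sqrt (by linarith [hnv b, hnq b])
  have h14n : (Real.sqrt 14) ^ n * (Real.sqrt 14) ^ n = 14 ^ n := by
    rw [← mul_pow, Real.mul_self_sqrt (by norm_num : (0 : ℝ) ≤ 14)]
  have hR0 : 0 ≤ (Real.sqrt 14) ^ n * ∏ a, Real.sqrt (∑ m, ‖F a m‖ ^ 2) := by positivity
  have hcol0 : 0 ≤ ∏ b, Real.sqrt (∑ x, ‖v b x‖ ^ 2 + ∑ x, ‖q b x‖ ^ 2) :=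
    Finset.prod_nonneg fun b _ => Real.sqrt_nonneg _
  calc (∏ a, Real.sqrt (∑ x, ‖u a x‖ ^ 2 + ∑ x, ‖p a x‖ ^ 2)) *
        ∏ b, Real.sqrt (∑ x, ‖v b x‖ ^ 2 + ∑ x, ‖q b x‖ ^ 2)
      ≤ ((Real.sqrt 14) ^ n * ∏ a, Real.sqrt (∑ m, ‖F a m‖ ^ 2)) *
          ((Real.sqrt 14) ^ n * ∏ b, Real.sqrt (∑ m, ‖G b m‖ ^ 2)) := mul_le_mul hrow hcol hcol0 hR0
    _ = 14 ^ n * ((∏ a, Real.sqrt (∑ m, ‖F a m‖ ^ 2)) * ∏ b, Real.sqrt (∑ m, ‖G b m‖ ^ 2)) := by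
        rw [← h14n]; ring


/-- **The same bound with an extra `ℓ¹` symbol per mode** (the form the single-scale ultraviolet step consumes: the
covariance ABOVE the infrared region is `c_M` minus a Gram kernel whose symbol `r_m(i') = -(1 - w(ν_{i'}, m))/(-iν_{i'} + ξ_m)`
is supported near the Fermi surface).  For any `r : μ → MatsubaraIdx M → ℂ`, the matrix
`Σ_m F_a(m) G_b(m) · β⁻¹ Σ_{i'} e^{-iν_{i'}(τ_{j_a} - τ_{l_b})} (1/(-iν_{i'} + ξ_m) + r_m(i'))` has
`|det| ≤ ∏_a √(2 Σ_m |F_a(m)|² (7 + ρ_m)) · ∏_b √(2 Σ_m |G_b(m)|² (7 + ρ_m))`, `ρ_m = β⁻¹ Σ_{i'} |r_m(i')|` (so `14ⁿ ∏‖F_a‖∏‖G_b‖`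
at `r = 0`, and a MODE-AVERAGED constant in general: `ρ_m` may blow up like `log β` at single modes as long as
`Σ_m |F_a(m)|² ρ_m` stays bounded).  Proof: as `norm_det_truncatedPropagator_grid_le`, with a third Gram block
`(F_a(m) e^{-iν_{i'} τ_{j_a}} (r/|r|) √(|r|/β), G_b(m) e^{iν_{i'} τ_{l_b}} √(|r|/β))` appended to both branches
(Pedra–Salmhofer 2008, Thm 1.3: Gram parts add their squared norms to `δ²`). [cite: PedraSalmhofer2008, Thm 1.3 and Lemma 4.1] -/
theorem norm_det_truncatedPropagator_grid_add_symbol_le {μ : Type*} [Fintype μ] (ξ : μ → ℝ) {β : ℝ} (hβ : 0 < β)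
    (M : ℕ) [NeZero M] (r : μ → MatsubaraIdx M → ℂ) {n : ℕ} (F G : Fin n → μ → ℂ)
    (j l : Fin n → Fin (2 * (2 * M))) :
    ‖(Matrix.of fun a b : Fin n =>
        ∑ m, F a m * G b m *
          (((1 / β : ℝ) : ℂ) * ∑ i' : MatsubaraIdx M,
            Complex.exp (-((matsubaraFreq β M i' *
                (gridTime β (2 * (2 * M)) (j a) - gridTime β (2 * (2 * M)) (l b)) : ℝ) : ℂ) * I) *
              (1 / (-((matsubaraFreq β M i' : ℝ) : ℂ) * I + (ξ m : ℂ)) + r m i'))).det‖ ≤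
      (∏ a, Real.sqrt (2 * ∑ m, ‖F a m‖ ^ 2 * (7 + 1 / β * ∑ i', ‖r m i'‖))) *
        ∏ b, Real.sqrt (2 * ∑ m, ‖G b m‖ ^ 2 * (7 + 1 / β * ∑ i', ‖r m i'‖)) := by
  classical
  have hNpos : 0 < 2 * (2 * M) := by have := NeZero.pos M; omega
  have hNr : (0 : ℝ) < ((2 * (2 * M) : ℕ) : ℝ) := by exact_mod_cast hNpos
  have hNne : ((2 * (2 * M) : ℕ) : ℝ) ≠ 0 := hNr.ne'
  have hε0 : 0 < β / (2 * (2 * M) : ℕ) := by positivity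
  have hεne : β / (2 * (2 * M) : ℕ) ≠ 0 := hε0.ne'
  have hεN : β / (2 * (2 * M) : ℕ) * ((2 * (2 * M) : ℕ) : ℝ) = β := by field_simp
  -- grid times: `τ_c = ε c ∈ [0, β]`, ordered like the indices
  have hgt : ∀ c : Fin (2 * (2 * M)), gridTime β (2 * (2 * M)) c = β / (2 * (2 * M) : ℕ) * ((c : ℕ) : ℝ) := by
    intro c
    simp only [gridTime]
    ring
  have hgt0 : ∀ c : Fin (2 * (2 * M)), 0 ≤ gridTime β (2 * (2 * M)) c := fun c => by
    rw [hgt]; positivity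
  have hgtβ : ∀ c : Fin (2 * (2 * M)), gridTime β (2 * (2 * M)) c ≤ β := by
    intro c
    rw [hgt]
    have hc : ((c : ℕ) : ℝ) ≤ ((2 * (2 * M) : ℕ) : ℝ) := by exact_mod_cast c.isLt.le
    calc β / (2 * (2 * M) : ℕ) * ((c : ℕ) : ℝ) ≤ β / (2 * (2 * M) : ℕ) * ((2 * (2 * M) : ℕ) : ℝ) :=
          mul_le_mul_of_nonneg_left hc hε0.le
      _ = β := hεN
  have hmono : ∀ c c' : Fin (2 * (2 * M)), (c : ℕ) ≤ (c' : ℕ) →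
      gridTime β (2 * (2 * M)) c ≤ gridTime β (2 * (2 * M)) c' := by
    intro c c' h
    rw [hgt, hgt]
    exact mul_le_mul_of_nonneg_left (by exact_mod_cast h) hε0.le
  -- the remainder symbol `d_i(ξ_m)` and the phases `e^{-iν_i ε j_a}`, `e^{iν_i ε l_b}`
  set D : μ → MatsubaraIdx (2 * M) → ℂ := fun m i =>
    (if M ≤ (i : ℕ) ∧ (i : ℕ) < 3 * M then
        (1 : ℂ) / (-((matsubaraFreq β (2 * M) i : ℝ) : ℂ) * I + (ξ m : ℂ)) else 0) -
      ((β / (2 * (2 * M) : ℕ) : ℝ) : ℂ) /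
        (1 - Complex.exp ((((matsubaraFreq β (2 * M) i : ℝ) : ℂ) * I - (ξ m : ℂ)) *
          ((β / (2 * (2 * M) : ℕ) : ℝ) : ℂ))) with hD
  have hDle : ∀ m i, ‖D m i‖ ≤ 6 * (β / (2 * (2 * M) : ℕ)) := fun m i => by
    simp only [hD]
    exact norm_truncationSymbol_le hβ (ξ m) M i
  set eJ : Fin n → MatsubaraIdx (2 * M) → ℂ := fun a i =>
    Complex.exp (-(((matsubaraFreq β (2 * M) i * (β / (2 * (2 * M) : ℕ)) * ((j a : ℕ) : ℝ)) : ℝ) : ℂ) * I)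
    with heJ
  set eL : Fin n → MatsubaraIdx (2 * M) → ℂ := fun b i =>
    Complex.exp ((((matsubaraFreq β (2 * M) i * (β / (2 * (2 * M) : ℕ)) * ((l b : ℕ) : ℝ)) : ℝ) : ℂ) * I)
    with heL
  have hneJ : ∀ a i, ‖eJ a i‖ = 1 := fun a i => by
    simp only [heJ]
    rw [← Complex.ofReal_neg, Complex.norm_exp_ofReal_mul_I]
  have hneL : ∀ b i, ‖eL b i‖ = 1 := fun b i => by
    simp only [heL]
    rw [Complex.norm_exp_ofReal_mul_I]
  have hphase : ∀ a b i, eJ a i * eL b i =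
      Complex.exp (((matsubaraFreq β (2 * M) i * (β / (2 * (2 * M) : ℕ)) *
        ((((l b : ℕ) : ℤ) - ((j a : ℕ) : ℤ) : ℤ) : ℝ) : ℝ) : ℂ) * I) := by
    intro a b i
    simp only [heJ, heL]
    rw [← Complex.exp_add]
    congr 1
    push_cast
    ring
  -- the global scale of the remainder block: `T = 6 N ε²`, `t = 1/√T`
  set T : ℝ := 6 * ((2 * (2 * M) : ℕ) : ℝ) * (β / (2 * (2 * M) : ℕ)) ^ 2 with hT
  have hT0 : 0 < T := by positivity
  have hsT : 0 < Real.sqrt T := Real.sqrt_pos.2 hT0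
  have hsTne : Real.sqrt T ≠ 0 := hsT.ne'
  set tR : ℝ := (Real.sqrt T)⁻¹ with htR
  have htR0 : 0 < tR := by positivity
  have htR2 : tR ^ 2 = T⁻¹ := by rw [htR, inv_pow, Real.sq_sqrt hT0.le]
  have hcβ : 0 ≤ Real.sqrt T / β := by positivity
  have htc : ((tR : ℝ) : ℂ) * (((Real.sqrt T / β) : ℝ) : ℂ) = ((1 / β : ℝ) : ℂ) := by
    rw [← Complex.ofReal_mul]
    congr 1
    rw [htR]
    field_simp
  have hRrow : ((2 * (2 * M) : ℕ) : ℝ) * ((6 * (β / (2 * (2 * M) : ℕ))) ^ 2 * tR ^ 2) = 6 := by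
    rw [htR2, hT]
    field_simp
  have hRcol : ((2 * (2 * M) : ℕ) : ℝ) * ((Real.sqrt T / β) ^ 2) = 6 := by
    rw [div_pow, Real.sq_sqrt hT0.le, hT]
    field_simp
  have hcardR : (Fintype.card (MatsubaraIdx (2 * M)) : ℝ) = ((2 * (2 * M) : ℕ) : ℝ) := by
    rw [Fintype.card_fin]
  -- the S-block (extra symbol `r`): phases at the kept frequencies and the per-entry scale `√(|r|/β)`
  set eJ' : Fin n → MatsubaraIdx M → ℂ := fun a i' =>
    Complex.exp (-(((matsubaraFreq β M i' * gridTime β (2 * (2 * M)) (j a)) : ℝ) : ℂ) * I) with heJ'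
  set eL' : Fin n → MatsubaraIdx M → ℂ := fun b i' =>
    Complex.exp ((((matsubaraFreq β M i' * gridTime β (2 * (2 * M)) (l b)) : ℝ) : ℂ) * I) with heL'
  have hneJ' : ∀ a i', ‖eJ' a i'‖ = 1 := fun a i' => by
    simp only [heJ']
    rw [← Complex.ofReal_neg, Complex.norm_exp_ofReal_mul_I]
  have hneL' : ∀ b i', ‖eL' b i'‖ = 1 := fun b i' => by
    simp only [heL']
    rw [Complex.norm_exp_ofReal_mul_I]
  have hphase' : ∀ a b i', eJ' a i' * eL' b i' =
      Complex.exp (-((matsubaraFreq β M i' *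
        (gridTime β (2 * (2 * M)) (j a) - gridTime β (2 * (2 * M)) (l b)) : ℝ) : ℂ) * I) := by
    intro a b i'
    simp only [heJ', heL']
    rw [← Complex.exp_add]
    congr 1
    push_cast
    ring
  have hS_prod : ∀ m i', (r m i' / (‖r m i'‖ : ℂ)) * ((Real.sqrt (‖r m i'‖ / β) : ℝ) : ℂ) *
      ((Real.sqrt (‖r m i'‖ / β) : ℝ) : ℂ) = r m i' * ((1 / β : ℝ) : ℂ) := by
    intro m i'
    have hs : ((Real.sqrt (‖r m i'‖ / β) : ℝ) : ℂ) * ((Real.sqrt (‖r m i'‖ / β) : ℝ) : ℂ) =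
        (((‖r m i'‖ / β) : ℝ) : ℂ) := by
      rw [← Complex.ofReal_mul, Real.mul_self_sqrt (by positivity)]
    rw [mul_assoc, hs]
    by_cases hr : r m i' = 0
    · simp [hr]
    · have hrn : ((‖r m i'‖ : ℝ) : ℂ) ≠ 0 := by exact_mod_cast (norm_ne_zero_iff.2 hr)
      have hβc : ((β : ℝ) : ℂ) ≠ 0 := by exact_mod_cast hβ.ne'
      push_cast
      field_simp
  -- the entries: `c_M + S = (K + R) + S` (`truncatedPropagator_grid_eq`), `R`, `S` in terms of the phases
  have hentry : ∀ a b : Fin n,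
      ∑ m, F a m * G b m *
          (((1 / β : ℝ) : ℂ) * ∑ i' : MatsubaraIdx M,
            Complex.exp (-((matsubaraFreq β M i' *
                (gridTime β (2 * (2 * M)) (j a) - gridTime β (2 * (2 * M)) (l b)) : ℝ) : ℂ) * I) *
              (1 / (-((matsubaraFreq β M i' : ℝ) : ℂ) * I + (ξ m : ℂ)) + r m i')) =
        ((if (l b : ℕ) ≤ (j a : ℕ) then
            ∑ m, F a m * G b m *
              ((Real.exp ((gridTime β (2 * (2 * M)) (j a) - gridTime β (2 * (2 * M)) (l b)) * (-ξ m)) *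
                (1 + Real.exp (β * (-ξ m)))⁻¹ : ℝ) : ℂ)
          else
            -∑ m, F a m * G b m *
              ((Real.exp ((gridTime β (2 * (2 * M)) (j a) - gridTime β (2 * (2 * M)) (l b)) * (-ξ m)) *
                (1 + Real.exp (-(β * (-ξ m))))⁻¹ : ℝ) : ℂ)) +
          ∑ m, F a m * G b m *
            (((1 / β : ℝ) : ℂ) * ∑ i : MatsubaraIdx (2 * M), eJ a i * eL b i * D m i)) +
        ∑ m, F a m * G b m *
          (((1 / β : ℝ) : ℂ) * ∑ i' : MatsubaraIdx M, eJ' a i' * eL' b i' * r m i') := by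
    intro a b
    have hm : ∀ m : μ,
        ((1 / β : ℝ) : ℂ) * ∑ i' : MatsubaraIdx M,
            Complex.exp (-((matsubaraFreq β M i' *
                (gridTime β (2 * (2 * M)) (j a) - gridTime β (2 * (2 * M)) (l b)) : ℝ) : ℂ) * I) /
              (-((matsubaraFreq β M i' : ℝ) : ℂ) * I + (ξ m : ℂ)) =
          (if (l b : ℕ) ≤ (j a : ℕ) then
              ((Real.exp ((gridTime β (2 * (2 * M)) (j a) - gridTime β (2 * (2 * M)) (l b)) * (-ξ m)) *
                (1 + Real.exp (β * (-ξ m)))⁻¹ : ℝ) : ℂ)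
            else
              -((Real.exp ((gridTime β (2 * (2 * M)) (j a) - gridTime β (2 * (2 * M)) (l b)) * (-ξ m)) *
                (1 + Real.exp (-(β * (-ξ m))))⁻¹ : ℝ) : ℂ)) +
            ((1 / β : ℝ) : ℂ) * ∑ i : MatsubaraIdx (2 * M), eJ a i * eL b i * D m i := by
      intro m
      rw [truncatedPropagator_grid_eq hβ (ξ m) M (j a) (l b)]
      congr 1
      congr 1
      refine Finset.sum_congr rfl fun i _ => ?_
      rw [hphase a b i]
    have hsplit : ∀ m : μ,
        ((1 / β : ℝ) : ℂ) * ∑ i' : MatsubaraIdx M,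
            Complex.exp (-((matsubaraFreq β M i' *
                (gridTime β (2 * (2 * M)) (j a) - gridTime β (2 * (2 * M)) (l b)) : ℝ) : ℂ) * I) *
              (1 / (-((matsubaraFreq β M i' : ℝ) : ℂ) * I + (ξ m : ℂ)) + r m i') =
          ((1 / β : ℝ) : ℂ) * ∑ i' : MatsubaraIdx M,
            Complex.exp (-((matsubaraFreq β M i' *
                (gridTime β (2 * (2 * M)) (j a) - gridTime β (2 * (2 * M)) (l b)) : ℝ) : ℂ) * I) /
              (-((matsubaraFreq β M i' : ℝ) : ℂ) * I + (ξ m : ℂ)) +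
            ((1 / β : ℝ) : ℂ) * ∑ i' : MatsubaraIdx M, eJ' a i' * eL' b i' * r m i' := by
      intro m
      rw [← mul_add, ← Finset.sum_add_distrib]
      congr 1
      refine Finset.sum_congr rfl fun i' _ => ?_
      rw [hphase' a b i', mul_add, mul_one_div]
    simp_rw [hsplit, hm]
    split_ifs with hab
    · rw [← Finset.sum_add_distrib, ← Finset.sum_add_distrib]
      exact Finset.sum_congr rfl fun m _ => by ring
    · rw [← Finset.sum_neg_distrib, ← Finset.sum_add_distrib, ← Finset.sum_add_distrib]
      exact Finset.sum_congr rfl fun m _ => by ring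
  -- K-block data, verbatim as in `norm_det_timeOrdered_modes_le` with `d = -ξ`, `s_a = τ_{j_a}`, `t_b = τ_{l_b}`
  set w : μ → ℝ := fun m => (1 + Real.exp (-(β * |-ξ m|)))⁻¹ with hw
  have hw0 : ∀ m, 0 ≤ w m := fun m => by positivity
  have hw1 : ∀ m, w m ≤ 1 := fun m => by
    simp only [hw]
    apply inv_le_one_of_one_le₀
    linarith [Real.exp_pos (-(β * |-ξ m|))]
  have hsqw : ∀ m, ((Real.sqrt (w m) : ℝ) : ℂ) * (Real.sqrt (w m) : ℂ) = (w m : ℂ) := fun m => by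
    rw [← Complex.ofReal_mul, Real.mul_self_sqrt (hw0 m)]
  set z₁ : μ → (Fin n ⊕ Fin n) → ℝ := fun m =>
    Sum.elim (fun a => gridTime β (2 * (2 * M)) (j a) - if 0 < -ξ m then β else 0)
      (fun b => gridTime β (2 * (2 * M)) (l b)) with hz₁
  set z₂ : μ → (Fin n ⊕ Fin n) → ℝ := fun m =>
    Sum.elim (fun a => gridTime β (2 * (2 * M)) (j a))
      (fun b => gridTime β (2 * (2 * M)) (l b) - if -ξ m < 0 then β else 0) with hz₂
  have hV : ∀ (m : μ) (z : (Fin n ⊕ Fin n) → ℝ), ∃ V : (Fin n ⊕ Fin n) → (Fin n ⊕ Fin n) → ℂ,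
      (∀ a b, ∑ r, star (V a r) * V b r = (Real.exp (-(|-ξ m| * |z a - z b|)) : ℂ)) ∧
        ∀ a, ∑ r, ‖V a r‖ ^ 2 = 1 := fun m z =>
    (isPosDefKernel_exp_neg_mul_abs_sub (abs_nonneg (-ξ m))).exists_gram_vectors
      (fun y => by simp) z
  choose V₁ hV₁ hV₁n using fun m => hV m (z₁ m)
  choose V₂ hV₂ hV₂n using fun m => hV m (z₂ m)
  -- coordinates: K-block and R-block families, and their concatenations
  set uK : Fin n → (μ × (Fin n ⊕ Fin n)) → ℂ :=
    fun a x => F a x.1 * (Real.sqrt (w x.1) : ℂ) * star (V₁ x.1 (Sum.inl a) x.2) with huK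
  set vK : Fin n → (μ × (Fin n ⊕ Fin n)) → ℂ :=
    fun b x => G b x.1 * (Real.sqrt (w x.1) : ℂ) * V₁ x.1 (Sum.inr b) x.2 with hvK
  set pK : Fin n → (μ × (Fin n ⊕ Fin n)) → ℂ :=
    fun a x => F a x.1 * (Real.sqrt (w x.1) : ℂ) * star (V₂ x.1 (Sum.inl a) x.2) with hpK
  set qK : Fin n → (μ × (Fin n ⊕ Fin n)) → ℂ :=
    fun b x => -(G b x.1 * (Real.sqrt (w x.1) : ℂ) * V₂ x.1 (Sum.inr b) x.2) with hqK
  set uR : Fin n → (μ × MatsubaraIdx (2 * M)) → ℂ :=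
    fun a y => F a y.1 * eJ a y.2 * D y.1 y.2 * (tR : ℂ) with huR
  set vR : Fin n → (μ × MatsubaraIdx (2 * M)) → ℂ :=
    fun b y => G b y.1 * eL b y.2 * (((Real.sqrt T / β) : ℝ) : ℂ) with hvR
  set uS : Fin n → (μ × MatsubaraIdx M) → ℂ :=
    fun a y => F a y.1 * eJ' a y.2 * (r y.1 y.2 / (‖r y.1 y.2‖ : ℂ)) *
      ((Real.sqrt (‖r y.1 y.2‖ / β) : ℝ) : ℂ) with huS
  set vS : Fin n → (μ × MatsubaraIdx M) → ℂ :=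
    fun b y => G b y.1 * eL' b y.2 * ((Real.sqrt (‖r y.1 y.2‖ / β) : ℝ) : ℂ) with hvS
  set u : Fin n → (((μ × (Fin n ⊕ Fin n)) ⊕ (μ × MatsubaraIdx (2 * M))) ⊕ (μ × MatsubaraIdx M)) → ℂ :=
    fun a => Sum.elim (Sum.elim (uK a) (uR a)) (uS a) with hu
  set v : Fin n → (((μ × (Fin n ⊕ Fin n)) ⊕ (μ × MatsubaraIdx (2 * M))) ⊕ (μ × MatsubaraIdx M)) → ℂ :=
    fun b => Sum.elim (Sum.elim (vK b) (vR b)) (vS b) with hv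
  set p : Fin n → (((μ × (Fin n ⊕ Fin n)) ⊕ (μ × MatsubaraIdx (2 * M))) ⊕ (μ × MatsubaraIdx M)) → ℂ :=
    fun a => Sum.elim (Sum.elim (pK a) (uR a)) (uS a) with hp
  set q : Fin n → (((μ × (Fin n ⊕ Fin n)) ⊕ (μ × MatsubaraIdx (2 * M))) ⊕ (μ × MatsubaraIdx M)) → ℂ :=
    fun b => Sum.elim (Sum.elim (qK b) (vR b)) (vS b) with hq
  have hsplit_uv : ∀ a b, ∑ x, u a x * v b x =
      (∑ x, uK a x * vK b x + ∑ y, uR a y * vR b y) + ∑ y, uS a y * vS b y := by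
    intro a b
    simp only [hu, hv, Fintype.sum_sum_type, Sum.elim_inl, Sum.elim_inr]
  have hsplit_pq : ∀ a b, ∑ x, p a x * q b x =
      (∑ x, pK a x * qK b x + ∑ y, uR a y * vR b y) + ∑ y, uS a y * vS b y := by
    intro a b
    simp only [hp, hq, Fintype.sum_sum_type, Sum.elim_inl, Sum.elim_inr]
  -- the S-block realises `Σ_m F_a(m) G_b(m) β⁻¹ Σ_{i'} e^{-iν_{i'}(τ_{j_a} - τ_{l_b})} r_m(i')`
  have hS : ∀ a b : Fin n, ∑ y, uS a y * vS b y =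
      ∑ m, F a m * G b m * (((1 / β : ℝ) : ℂ) * ∑ i' : MatsubaraIdx M, eJ' a i' * eL' b i' * r m i') := by
    intro a b
    rw [Fintype.sum_prod_type]
    refine Finset.sum_congr rfl fun m _ => ?_
    rw [Finset.mul_sum, Finset.mul_sum]
    refine Finset.sum_congr rfl fun i' _ => ?_
    simp only [huS, hvS]
    calc F a m * eJ' a i' * (r m i' / (‖r m i'‖ : ℂ)) * ((Real.sqrt (‖r m i'‖ / β) : ℝ) : ℂ) *
          (G b m * eL' b i' * ((Real.sqrt (‖r m i'‖ / β) : ℝ) : ℂ))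
        = F a m * G b m * (eJ' a i' * eL' b i') *
            ((r m i' / (‖r m i'‖ : ℂ)) * ((Real.sqrt (‖r m i'‖ / β) : ℝ) : ℂ) *
              ((Real.sqrt (‖r m i'‖ / β) : ℝ) : ℂ)) := by ring
      _ = F a m * G b m * (eJ' a i' * eL' b i') * (r m i' * ((1 / β : ℝ) : ℂ)) := by rw [hS_prod m i']
      _ = F a m * G b m * (((1 / β : ℝ) : ℂ) * (eJ' a i' * eL' b i' * r m i')) := by ring
  -- the R-block realises `Σ_m F_a(m) G_b(m) β⁻¹ Σ_i e^{iν_i ε(l_b - j_a)} d_i(ξ_m)`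
  have hR : ∀ a b : Fin n, ∑ y, uR a y * vR b y =
      ∑ m, F a m * G b m * (((1 / β : ℝ) : ℂ) * ∑ i : MatsubaraIdx (2 * M), eJ a i * eL b i * D m i) := by
    intro a b
    rw [Fintype.sum_prod_type]
    refine Finset.sum_congr rfl fun m _ => ?_
    rw [Finset.mul_sum, Finset.mul_sum]
    refine Finset.sum_congr rfl fun i _ => ?_
    simp only [huR, hvR]
    rw [← htc]
    ring
  -- the K-block realises the chronological kernel (Pedra–Salmhofer Lemma 4.1)
  have honK : ∀ a b : Fin n, (l b : ℕ) ≤ (j a : ℕ) → ∑ x, uK a x * vK b x =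
      ∑ m, F a m * G b m *
        ((Real.exp ((gridTime β (2 * (2 * M)) (j a) - gridTime β (2 * (2 * M)) (l b)) * (-ξ m)) *
          (1 + Real.exp (β * (-ξ m)))⁻¹ : ℝ) : ℂ) := by
    intro a b hab
    have htsa : gridTime β (2 * (2 * M)) (l b) ≤ gridTime β (2 * (2 * M)) (j a) := hmono _ _ hab
    rw [Fintype.sum_prod_type]
    refine Finset.sum_congr rfl fun m _ => ?_
    have e1 : ∀ r, uK a (m, r) * vK b (m, r) = F a m * G b m * (w m : ℂ) *
        (star (V₁ m (Sum.inl a) r) * V₁ m (Sum.inr b) r) := by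
      intro r
      simp only [huK, hvK]
      rw [← hsqw m]
      ring
    simp_rw [e1]
    rw [← Finset.mul_sum, hV₁ m, timeKernel_on_eq (-ξ m) β _ _ htsa (hgtβ _) (hgt0 _)]
    simp only [hz₁, Sum.elim_inl, Sum.elim_inr, hw]
    push_cast
    ring_nf
  have hoffK : ∀ a b : Fin n, ¬ (l b : ℕ) ≤ (j a : ℕ) → ∑ x, pK a x * qK b x =
      -∑ m, F a m * G b m *
        ((Real.exp ((gridTime β (2 * (2 * M)) (j a) - gridTime β (2 * (2 * M)) (l b)) * (-ξ m)) *
          (1 + Real.exp (-(β * (-ξ m))))⁻¹ : ℝ) : ℂ) := by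
    intro a b hab
    have hsat : gridTime β (2 * (2 * M)) (j a) ≤ gridTime β (2 * (2 * M)) (l b) :=
      hmono _ _ (Nat.le_of_lt (Nat.lt_of_not_le hab))
    rw [Fintype.sum_prod_type, ← Finset.sum_neg_distrib]
    refine Finset.sum_congr rfl fun m _ => ?_
    have e1 : ∀ r, pK a (m, r) * qK b (m, r) = -(F a m * G b m * (w m : ℂ) *
        (star (V₂ m (Sum.inl a) r) * V₂ m (Sum.inr b) r)) := by
      intro r
      simp only [hpK, hqK]
      rw [← hsqw m]
      ring
    simp_rw [e1]
    rw [Finset.sum_neg_distrib, ← Finset.mul_sum, hV₂ m,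
      timeKernel_off_eq (-ξ m) β _ _ hsat (hgt0 _) (hgtβ _)]
    simp only [hz₂, Sum.elim_inl, Sum.elim_inr, hw]
    push_cast
    ring_nf
  -- the realisation as a chronological product
  have hM : (Matrix.of fun a b : Fin n =>
        ∑ m, F a m * G b m *
          (((1 / β : ℝ) : ℂ) * ∑ i' : MatsubaraIdx M,
            Complex.exp (-((matsubaraFreq β M i' *
                (gridTime β (2 * (2 * M)) (j a) - gridTime β (2 * (2 * M)) (l b)) : ℝ) : ℂ) * I) *
              (1 / (-((matsubaraFreq β M i' : ℝ) : ℂ) * I + (ξ m : ℂ)) + r m i'))) =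
      Matrix.of fun a b : Fin n =>
        if (l b : ℕ) ≤ (j a : ℕ) then ∑ x, u a x * v b x else ∑ x, p a x * q b x := by
    ext a b
    simp only [Matrix.of_apply]
    rw [hentry a b]
    split_ifs with hab
    · rw [hsplit_uv, honK a b hab, hR, hS]
    · rw [hsplit_pq, hoffK a b hab, hR, hS]
  rw [hM]
  refine (norm_det_chronological_le_of_times' (J := ℕ) (fun a => (j a : ℕ)) (fun b => (l b : ℕ)) u v p q).trans ?_
  -- norms: K-blocks `≤ Σ_m |F_a(m)|²`, R-blocks `≤ 6 Σ_m |F_a(m)|²`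
  have hnuK : ∀ a, ∑ x, ‖uK a x‖ ^ 2 ≤ ∑ m, ‖F a m‖ ^ 2 := by
    intro a
    rw [Fintype.sum_prod_type]
    refine Finset.sum_le_sum fun m _ => ?_
    have e1 : ∀ r, ‖uK a (m, r)‖ ^ 2 = ‖F a m‖ ^ 2 * w m * ‖V₁ m (Sum.inl a) r‖ ^ 2 := by
      intro r
      simp only [huK, norm_mul, norm_star, Complex.norm_real, Real.norm_eq_abs,
        abs_of_nonneg (Real.sqrt_nonneg _), mul_pow, Real.sq_sqrt (hw0 m)]
    simp_rw [e1]
    rw [← Finset.mul_sum, hV₁n m, mul_one]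
    exact mul_le_of_le_one_right (by positivity) (hw1 m)
  have hnpK : ∀ a, ∑ x, ‖pK a x‖ ^ 2 ≤ ∑ m, ‖F a m‖ ^ 2 := by
    intro a
    rw [Fintype.sum_prod_type]
    refine Finset.sum_le_sum fun m _ => ?_
    have e1 : ∀ r, ‖pK a (m, r)‖ ^ 2 = ‖F a m‖ ^ 2 * w m * ‖V₂ m (Sum.inl a) r‖ ^ 2 := by
      intro r
      simp only [hpK, norm_mul, norm_star, Complex.norm_real, Real.norm_eq_abs,
        abs_of_nonneg (Real.sqrt_nonneg _), mul_pow, Real.sq_sqrt (hw0 m)]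
    simp_rw [e1]
    rw [← Finset.mul_sum, hV₂n m, mul_one]
    exact mul_le_of_le_one_right (by positivity) (hw1 m)
  have hnvK : ∀ b, ∑ x, ‖vK b x‖ ^ 2 ≤ ∑ m, ‖G b m‖ ^ 2 := by
    intro b
    rw [Fintype.sum_prod_type]
    refine Finset.sum_le_sum fun m _ => ?_
    have e1 : ∀ r, ‖vK b (m, r)‖ ^ 2 = ‖G b m‖ ^ 2 * w m * ‖V₁ m (Sum.inr b) r‖ ^ 2 := by
      intro r
      simp only [hvK, norm_mul, Complex.norm_real, Real.norm_eq_abs,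
        abs_of_nonneg (Real.sqrt_nonneg _), mul_pow, Real.sq_sqrt (hw0 m)]
    simp_rw [e1]
    rw [← Finset.mul_sum, hV₁n m, mul_one]
    exact mul_le_of_le_one_right (by positivity) (hw1 m)
  have hnqK : ∀ b, ∑ x, ‖qK b x‖ ^ 2 ≤ ∑ m, ‖G b m‖ ^ 2 := by
    intro b
    rw [Fintype.sum_prod_type]
    refine Finset.sum_le_sum fun m _ => ?_
    have e1 : ∀ r, ‖qK b (m, r)‖ ^ 2 = ‖G b m‖ ^ 2 * w m * ‖V₂ m (Sum.inr b) r‖ ^ 2 := by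
      intro r
      simp only [hqK, norm_neg, norm_mul, Complex.norm_real, Real.norm_eq_abs,
        abs_of_nonneg (Real.sqrt_nonneg _), mul_pow, Real.sq_sqrt (hw0 m)]
    simp_rw [e1]
    rw [← Finset.mul_sum, hV₂n m, mul_one]
    exact mul_le_of_le_one_right (by positivity) (hw1 m)
  have hnuR : ∀ a, ∑ y, ‖uR a y‖ ^ 2 ≤ 6 * ∑ m, ‖F a m‖ ^ 2 := by
    intro a
    rw [Fintype.sum_prod_type, Finset.mul_sum]
    refine Finset.sum_le_sum fun m _ => ?_
    have e1 : ∀ i, ‖uR a (m, i)‖ ^ 2 = ‖F a m‖ ^ 2 * (‖D m i‖ ^ 2 * tR ^ 2) := by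
      intro i
      simp only [huR, norm_mul, Complex.norm_real, Real.norm_of_nonneg htR0.le]
      rw [hneJ]
      ring
    simp_rw [e1]
    rw [← Finset.mul_sum]
    have hsum : ∑ i : MatsubaraIdx (2 * M), ‖D m i‖ ^ 2 * tR ^ 2 ≤ 6 := by
      calc ∑ i : MatsubaraIdx (2 * M), ‖D m i‖ ^ 2 * tR ^ 2
          ≤ ∑ _i : MatsubaraIdx (2 * M), (6 * (β / (2 * (2 * M) : ℕ))) ^ 2 * tR ^ 2 := by
            refine Finset.sum_le_sum fun i _ => ?_
            have h1 : ‖D m i‖ ^ 2 ≤ (6 * (β / (2 * (2 * M) : ℕ))) ^ 2 :=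
              pow_le_pow_left₀ (norm_nonneg _) (hDle m i) 2
            exact mul_le_mul_of_nonneg_right h1 (sq_nonneg _)
        _ = 6 := by
            rw [Finset.sum_const, Finset.card_univ, nsmul_eq_mul, hcardR]
            exact hRrow
    calc ‖F a m‖ ^ 2 * ∑ i : MatsubaraIdx (2 * M), ‖D m i‖ ^ 2 * tR ^ 2 ≤ ‖F a m‖ ^ 2 * 6 :=
          mul_le_mul_of_nonneg_left hsum (sq_nonneg _)
      _ = 6 * ‖F a m‖ ^ 2 := by ring
  have hnvR : ∀ b, ∑ y, ‖vR b y‖ ^ 2 ≤ 6 * ∑ m, ‖G b m‖ ^ 2 := by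
    intro b
    rw [Fintype.sum_prod_type, Finset.mul_sum]
    refine Finset.sum_le_sum fun m _ => ?_
    have e1 : ∀ i, ‖vR b (m, i)‖ ^ 2 = ‖G b m‖ ^ 2 * (Real.sqrt T / β) ^ 2 := by
      intro i
      simp only [hvR, norm_mul, Complex.norm_real, Real.norm_of_nonneg hcβ]
      rw [hneL]
      ring
    simp_rw [e1]
    rw [Finset.sum_const, Finset.card_univ, nsmul_eq_mul, hcardR]
    calc ((2 * (2 * M) : ℕ) : ℝ) * (‖G b m‖ ^ 2 * (Real.sqrt T / β) ^ 2)
        = (((2 * (2 * M) : ℕ) : ℝ) * (Real.sqrt T / β) ^ 2) * ‖G b m‖ ^ 2 := by ring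
      _ = 6 * ‖G b m‖ ^ 2 := by rw [hRcol]
      _ ≤ 6 * ‖G b m‖ ^ 2 := le_rfl
  have hnuS : ∀ a, ∑ y, ‖uS a y‖ ^ 2 ≤ ∑ m, ‖F a m‖ ^ 2 * (1 / β * ∑ i', ‖r m i'‖) := by
    intro a
    rw [Fintype.sum_prod_type]
    refine Finset.sum_le_sum fun m _ => ?_
    have e1 : ∀ i', ‖uS a (m, i')‖ ^ 2 ≤ ‖F a m‖ ^ 2 * (‖r m i'‖ / β) := by
      intro i'
      have hq : ‖r m i' / (‖r m i'‖ : ℂ)‖ ≤ 1 := by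
        rw [norm_div, Complex.norm_real, Real.norm_of_nonneg (norm_nonneg _)]
        exact div_self_le_one _
      have hq2 : ‖r m i' / (‖r m i'‖ : ℂ)‖ ^ 2 ≤ 1 := pow_le_one₀ (norm_nonneg _) hq
      have hs2 : Real.sqrt (‖r m i'‖ / β) ^ 2 = ‖r m i'‖ / β := Real.sq_sqrt (by positivity)
      have e : ‖uS a (m, i')‖ = ‖F a m‖ * ‖r m i' / (‖r m i'‖ : ℂ)‖ * Real.sqrt (‖r m i'‖ / β) := by
        simp only [huS, norm_mul, Complex.norm_real, Real.norm_of_nonneg (Real.sqrt_nonneg _), hneJ', mul_one]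
      rw [e, mul_pow, mul_pow, hs2]
      calc ‖F a m‖ ^ 2 * ‖r m i' / (‖r m i'‖ : ℂ)‖ ^ 2 * (‖r m i'‖ / β)
          ≤ ‖F a m‖ ^ 2 * 1 * (‖r m i'‖ / β) :=
            mul_le_mul_of_nonneg_right (mul_le_mul_of_nonneg_left hq2 (sq_nonneg _)) (by positivity)
        _ = ‖F a m‖ ^ 2 * (‖r m i'‖ / β) := by ring
    calc ∑ i', ‖uS a (m, i')‖ ^ 2 ≤ ∑ i', ‖F a m‖ ^ 2 * (‖r m i'‖ / β) :=
          Finset.sum_le_sum fun i' _ => e1 i'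
      _ = ‖F a m‖ ^ 2 * (1 / β * ∑ i', ‖r m i'‖) := by
          rw [Finset.mul_sum, Finset.mul_sum]
          exact Finset.sum_congr rfl fun i' _ => by ring
  have hnvS : ∀ b, ∑ y, ‖vS b y‖ ^ 2 ≤ ∑ m, ‖G b m‖ ^ 2 * (1 / β * ∑ i', ‖r m i'‖) := by
    intro b
    rw [Fintype.sum_prod_type]
    refine Finset.sum_le_sum fun m _ => ?_
    have e1 : ∀ i', ‖vS b (m, i')‖ ^ 2 = ‖G b m‖ ^ 2 * (‖r m i'‖ / β) := by
      intro i'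
      have hs2 : Real.sqrt (‖r m i'‖ / β) ^ 2 = ‖r m i'‖ / β := Real.sq_sqrt (by positivity)
      have e : ‖vS b (m, i')‖ = ‖G b m‖ * Real.sqrt (‖r m i'‖ / β) := by
        simp only [hvS, norm_mul, Complex.norm_real, Real.norm_of_nonneg (Real.sqrt_nonneg _), hneL', mul_one]
      rw [e, mul_pow, hs2]
    simp_rw [e1]
    rw [Finset.mul_sum, Finset.mul_sum]
    exact le_of_eq (Finset.sum_congr rfl fun i' _ => by ring)
  have hsumF : ∀ a, ∑ m, ‖F a m‖ ^ 2 * (7 + (1 / β * ∑ i', ‖r m i'‖)) =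
      7 * ∑ m, ‖F a m‖ ^ 2 + ∑ m, ‖F a m‖ ^ 2 * (1 / β * ∑ i', ‖r m i'‖) := by
    intro a
    rw [Finset.mul_sum, ← Finset.sum_add_distrib]
    exact Finset.sum_congr rfl fun m _ => by ring
  have hsumG : ∀ b, ∑ m, ‖G b m‖ ^ 2 * (7 + (1 / β * ∑ i', ‖r m i'‖)) =
      7 * ∑ m, ‖G b m‖ ^ 2 + ∑ m, ‖G b m‖ ^ 2 * (1 / β * ∑ i', ‖r m i'‖) := by
    intro b
    rw [Finset.mul_sum, ← Finset.sum_add_distrib]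
    exact Finset.sum_congr rfl fun m _ => by ring
  have hnu : ∀ a, ∑ x, ‖u a x‖ ^ 2 ≤ ∑ m, ‖F a m‖ ^ 2 * (7 + (1 / β * ∑ i', ‖r m i'‖)) := by
    intro a
    have : ∑ x, ‖u a x‖ ^ 2 = (∑ x, ‖uK a x‖ ^ 2 + ∑ y, ‖uR a y‖ ^ 2) + ∑ y, ‖uS a y‖ ^ 2 := by
      simp only [hu, Fintype.sum_sum_type, Sum.elim_inl, Sum.elim_inr]
    rw [this, hsumF a]
    linarith [hnuK a, hnuR a, hnuS a]
  have hnp : ∀ a, ∑ x, ‖p a x‖ ^ 2 ≤ ∑ m, ‖F a m‖ ^ 2 * (7 + (1 / β * ∑ i', ‖r m i'‖)) := by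
    intro a
    have : ∑ x, ‖p a x‖ ^ 2 = (∑ x, ‖pK a x‖ ^ 2 + ∑ y, ‖uR a y‖ ^ 2) + ∑ y, ‖uS a y‖ ^ 2 := by
      simp only [hp, Fintype.sum_sum_type, Sum.elim_inl, Sum.elim_inr]
    rw [this, hsumF a]
    linarith [hnpK a, hnuR a, hnuS a]
  have hnv : ∀ b, ∑ x, ‖v b x‖ ^ 2 ≤ ∑ m, ‖G b m‖ ^ 2 * (7 + (1 / β * ∑ i', ‖r m i'‖)) := by
    intro b
    have : ∑ x, ‖v b x‖ ^ 2 = (∑ x, ‖vK b x‖ ^ 2 + ∑ y, ‖vR b y‖ ^ 2) + ∑ y, ‖vS b y‖ ^ 2 := by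
      simp only [hv, Fintype.sum_sum_type, Sum.elim_inl, Sum.elim_inr]
    rw [this, hsumG b]
    linarith [hnvK b, hnvR b, hnvS b]
  have hnq : ∀ b, ∑ x, ‖q b x‖ ^ 2 ≤ ∑ m, ‖G b m‖ ^ 2 * (7 + (1 / β * ∑ i', ‖r m i'‖)) := by
    intro b
    have : ∑ x, ‖q b x‖ ^ 2 = (∑ x, ‖qK b x‖ ^ 2 + ∑ y, ‖vR b y‖ ^ 2) + ∑ y, ‖vS b y‖ ^ 2 := by
      simp only [hq, Fintype.sum_sum_type, Sum.elim_inl, Sum.elim_inr]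
    rw [this, hsumG b]
    linarith [hnqK b, hnvR b, hnvS b]
  -- assemble
  have hrow : (∏ a, Real.sqrt (∑ x, ‖u a x‖ ^ 2 + ∑ x, ‖p a x‖ ^ 2)) ≤
      ∏ a, Real.sqrt (2 * ∑ m, ‖F a m‖ ^ 2 * (7 + (1 / β * ∑ i', ‖r m i'‖))) :=
    Finset.prod_le_prod (fun a _ => Real.sqrt_nonneg _) fun a _ =>
      Real.sqrt_le_sqrt (by linarith [hnu a, hnp a])
  have hcol : (∏ b, Real.sqrt (∑ x, ‖v b x‖ ^ 2 + ∑ x, ‖q b x‖ ^ 2)) ≤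
      ∏ b, Real.sqrt (2 * ∑ m, ‖G b m‖ ^ 2 * (7 + (1 / β * ∑ i', ‖r m i'‖))) :=
    Finset.prod_le_prod (fun b _ => Real.sqrt_nonneg _) fun b _ =>
      Real.sqrt_le_sqrt (by linarith [hnv b, hnq b])
  exact mul_le_mul hrow hcol (Finset.prod_nonneg fun b _ => Real.sqrt_nonneg _)
    (Finset.prod_nonneg fun a _ => Real.sqrt_nonneg _)


/-- **The same bound plus a Gram block** (the shape `norm_det_fermiTimeKernel_add_gram_le` has for the untruncated kernel;
asked for by the single-scale step, whose scale-0 covariance is `c_M` minus an infrared Gram kernel): for Gram data `P, Q` on any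
finite index type, `‖det [Σ_m F_a(m) G_b(m) c_M(ξ_m; τ_{j_a} - τ_{l_b}) + Σ_{m'} P_a(m') Q_b(m')]‖ ≤ 14ⁿ ∏_a √(‖F_a‖² + ‖P_a‖²) ∏_b √(‖G_b‖² + ‖Q_b‖²)`
for every `M ≥ 1` (the Gram block is appended to both branches: `‖u_a‖² + ‖p_a‖² ≤ 14‖F_a‖² + 2‖P_a‖²`).
[cite: PedraSalmhofer2008, Thm 1.3 and Lemma 4.1] -/
theorem norm_det_truncatedPropagator_grid_add_gram_le {μ ν' : Type*} [Fintype μ] [Fintype ν'] (ξ : μ → ℝ) {β : ℝ}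
    (hβ : 0 < β) (M : ℕ) [NeZero M] {n : ℕ} (F G : Fin n → μ → ℂ) (P Q : Fin n → ν' → ℂ)
    (j l : Fin n → Fin (2 * (2 * M))) :
    ‖(Matrix.of fun a b : Fin n =>
        (∑ m, F a m * G b m *
          (((1 / β : ℝ) : ℂ) * ∑ i' : MatsubaraIdx M,
            Complex.exp (-((matsubaraFreq β M i' *
                (gridTime β (2 * (2 * M)) (j a) - gridTime β (2 * (2 * M)) (l b)) : ℝ) : ℂ) * I) /
              (-((matsubaraFreq β M i' : ℝ) : ℂ) * I + (ξ m : ℂ)))) + ∑ m', P a m' * Q b m').det‖ ≤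
      14 ^ n * ((∏ a, Real.sqrt (∑ m, ‖F a m‖ ^ 2 + ∑ m', ‖P a m'‖ ^ 2)) *
        ∏ b, Real.sqrt (∑ m, ‖G b m‖ ^ 2 + ∑ m', ‖Q b m'‖ ^ 2)) := by
  classical
  have hNpos : 0 < 2 * (2 * M) := by have := NeZero.pos M; omega
  have hNr : (0 : ℝ) < ((2 * (2 * M) : ℕ) : ℝ) := by exact_mod_cast hNpos
  have hNne : ((2 * (2 * M) : ℕ) : ℝ) ≠ 0 := hNr.ne'
  have hε0 : 0 < β / (2 * (2 * M) : ℕ) := by positivity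
  have hεne : β / (2 * (2 * M) : ℕ) ≠ 0 := hε0.ne'
  have hεN : β / (2 * (2 * M) : ℕ) * ((2 * (2 * M) : ℕ) : ℝ) = β := by field_simp
  -- grid times: `τ_c = ε c ∈ [0, β]`, ordered like the indices
  have hgt : ∀ c : Fin (2 * (2 * M)), gridTime β (2 * (2 * M)) c = β / (2 * (2 * M) : ℕ) * ((c : ℕ) : ℝ) := by
    intro c
    simp only [gridTime]
    ring
  have hgt0 : ∀ c : Fin (2 * (2 * M)), 0 ≤ gridTime β (2 * (2 * M)) c := fun c => by
    rw [hgt]; positivity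
  have hgtβ : ∀ c : Fin (2 * (2 * M)), gridTime β (2 * (2 * M)) c ≤ β := by
    intro c
    rw [hgt]
    have hc : ((c : ℕ) : ℝ) ≤ ((2 * (2 * M) : ℕ) : ℝ) := by exact_mod_cast c.isLt.le
    calc β / (2 * (2 * M) : ℕ) * ((c : ℕ) : ℝ) ≤ β / (2 * (2 * M) : ℕ) * ((2 * (2 * M) : ℕ) : ℝ) :=
          mul_le_mul_of_nonneg_left hc hε0.le
      _ = β := hεN
  have hmono : ∀ c c' : Fin (2 * (2 * M)), (c : ℕ) ≤ (c' : ℕ) →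
      gridTime β (2 * (2 * M)) c ≤ gridTime β (2 * (2 * M)) c' := by
    intro c c' h
    rw [hgt, hgt]
    exact mul_le_mul_of_nonneg_left (by exact_mod_cast h) hε0.le
  -- the remainder symbol `d_i(ξ_m)` and the phases `e^{-iν_i ε j_a}`, `e^{iν_i ε l_b}`
  set D : μ → MatsubaraIdx (2 * M) → ℂ := fun m i =>
    (if M ≤ (i : ℕ) ∧ (i : ℕ) < 3 * M then
        (1 : ℂ) / (-((matsubaraFreq β (2 * M) i : ℝ) : ℂ) * I + (ξ m : ℂ)) else 0) -
      ((β / (2 * (2 * M) : ℕ) : ℝ) : ℂ) /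
        (1 - Complex.exp ((((matsubaraFreq β (2 * M) i : ℝ) : ℂ) * I - (ξ m : ℂ)) *
          ((β / (2 * (2 * M) : ℕ) : ℝ) : ℂ))) with hD
  have hDle : ∀ m i, ‖D m i‖ ≤ 6 * (β / (2 * (2 * M) : ℕ)) := fun m i => by
    simp only [hD]
    exact norm_truncationSymbol_le hβ (ξ m) M i
  set eJ : Fin n → MatsubaraIdx (2 * M) → ℂ := fun a i =>
    Complex.exp (-(((matsubaraFreq β (2 * M) i * (β / (2 * (2 * M) : ℕ)) * ((j a : ℕ) : ℝ)) : ℝ) : ℂ) * I)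
    with heJ
  set eL : Fin n → MatsubaraIdx (2 * M) → ℂ := fun b i =>
    Complex.exp ((((matsubaraFreq β (2 * M) i * (β / (2 * (2 * M) : ℕ)) * ((l b : ℕ) : ℝ)) : ℝ) : ℂ) * I)
    with heL
  have hneJ : ∀ a i, ‖eJ a i‖ = 1 := fun a i => by
    simp only [heJ]
    rw [← Complex.ofReal_neg, Complex.norm_exp_ofReal_mul_I]
  have hneL : ∀ b i, ‖eL b i‖ = 1 := fun b i => by
    simp only [heL]
    rw [Complex.norm_exp_ofReal_mul_I]
  have hphase : ∀ a b i, eJ a i * eL b i =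
      Complex.exp (((matsubaraFreq β (2 * M) i * (β / (2 * (2 * M) : ℕ)) *
        ((((l b : ℕ) : ℤ) - ((j a : ℕ) : ℤ) : ℤ) : ℝ) : ℝ) : ℂ) * I) := by
    intro a b i
    simp only [heJ, heL]
    rw [← Complex.exp_add]
    congr 1
    push_cast
    ring
  -- the global scale of the remainder block: `T = 6 N ε²`, `t = 1/√T`
  set T : ℝ := 6 * ((2 * (2 * M) : ℕ) : ℝ) * (β / (2 * (2 * M) : ℕ)) ^ 2 with hT
  have hT0 : 0 < T := by positivity
  have hsT : 0 < Real.sqrt T := Real.sqrt_pos.2 hT0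
  have hsTne : Real.sqrt T ≠ 0 := hsT.ne'
  set tR : ℝ := (Real.sqrt T)⁻¹ with htR
  have htR0 : 0 < tR := by positivity
  have htR2 : tR ^ 2 = T⁻¹ := by rw [htR, inv_pow, Real.sq_sqrt hT0.le]
  have hcβ : 0 ≤ Real.sqrt T / β := by positivity
  have htc : ((tR : ℝ) : ℂ) * (((Real.sqrt T / β) : ℝ) : ℂ) = ((1 / β : ℝ) : ℂ) := by
    rw [← Complex.ofReal_mul]
    congr 1
    rw [htR]
    field_simp
  have hRrow : ((2 * (2 * M) : ℕ) : ℝ) * ((6 * (β / (2 * (2 * M) : ℕ))) ^ 2 * tR ^ 2) = 6 := by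
    rw [htR2, hT]
    field_simp
  have hRcol : ((2 * (2 * M) : ℕ) : ℝ) * ((Real.sqrt T / β) ^ 2) = 6 := by
    rw [div_pow, Real.sq_sqrt hT0.le, hT]
    field_simp
  have hcardR : (Fintype.card (MatsubaraIdx (2 * M)) : ℝ) = ((2 * (2 * M) : ℕ) : ℝ) := by
    rw [Fintype.card_fin]
  -- the entries: `c_M = K + R` (`truncatedPropagator_grid_eq`), `R` in terms of the phases and `D`
  have hentry : ∀ a b : Fin n,
      ∑ m, F a m * G b m *
          (((1 / β : ℝ) : ℂ) * ∑ i' : MatsubaraIdx M,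
            Complex.exp (-((matsubaraFreq β M i' *
                (gridTime β (2 * (2 * M)) (j a) - gridTime β (2 * (2 * M)) (l b)) : ℝ) : ℂ) * I) /
              (-((matsubaraFreq β M i' : ℝ) : ℂ) * I + (ξ m : ℂ))) =
        (if (l b : ℕ) ≤ (j a : ℕ) then
            ∑ m, F a m * G b m *
              ((Real.exp ((gridTime β (2 * (2 * M)) (j a) - gridTime β (2 * (2 * M)) (l b)) * (-ξ m)) *
                (1 + Real.exp (β * (-ξ m)))⁻¹ : ℝ) : ℂ)
          else
            -∑ m, F a m * G b m *
              ((Real.exp ((gridTime β (2 * (2 * M)) (j a) - gridTime β (2 * (2 * M)) (l b)) * (-ξ m)) *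
                (1 + Real.exp (-(β * (-ξ m))))⁻¹ : ℝ) : ℂ)) +
          ∑ m, F a m * G b m *
            (((1 / β : ℝ) : ℂ) * ∑ i : MatsubaraIdx (2 * M), eJ a i * eL b i * D m i) := by
    intro a b
    have hm : ∀ m : μ,
        ((1 / β : ℝ) : ℂ) * ∑ i' : MatsubaraIdx M,
            Complex.exp (-((matsubaraFreq β M i' *
                (gridTime β (2 * (2 * M)) (j a) - gridTime β (2 * (2 * M)) (l b)) : ℝ) : ℂ) * I) /
              (-((matsubaraFreq β M i' : ℝ) : ℂ) * I + (ξ m : ℂ)) =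
          (if (l b : ℕ) ≤ (j a : ℕ) then
              ((Real.exp ((gridTime β (2 * (2 * M)) (j a) - gridTime β (2 * (2 * M)) (l b)) * (-ξ m)) *
                  (1 + Real.exp (β * (-ξ m)))⁻¹ : ℝ) : ℂ)
            else
              -((Real.exp ((gridTime β (2 * (2 * M)) (j a) - gridTime β (2 * (2 * M)) (l b)) * (-ξ m)) *
                  (1 + Real.exp (-(β * (-ξ m))))⁻¹ : ℝ) : ℂ)) +
            ((1 / β : ℝ) : ℂ) * ∑ i : MatsubaraIdx (2 * M), eJ a i * eL b i * D m i := by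
      intro m
      rw [truncatedPropagator_grid_eq hβ (ξ m) M (j a) (l b)]
      congr 1
      congr 1
      refine Finset.sum_congr rfl fun i _ => ?_
      rw [hphase a b i]
    simp_rw [hm]
    split_ifs with hab
    · rw [← Finset.sum_add_distrib]
      exact Finset.sum_congr rfl fun m _ => by ring
    · rw [← Finset.sum_neg_distrib, ← Finset.sum_add_distrib]
      exact Finset.sum_congr rfl fun m _ => by ring
  -- K-block data, verbatim as in `norm_det_timeOrdered_modes_le` with `d = -ξ`, `s_a = τ_{j_a}`, `t_b = τ_{l_b}`
  set w : μ → ℝ := fun m => (1 + Real.exp (-(β * |-ξ m|)))⁻¹ with hw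
  have hw0 : ∀ m, 0 ≤ w m := fun m => by positivity
  have hw1 : ∀ m, w m ≤ 1 := fun m => by
    simp only [hw]
    apply inv_le_one_of_one_le₀
    linarith [Real.exp_pos (-(β * |-ξ m|))]
  have hsqw : ∀ m, ((Real.sqrt (w m) : ℝ) : ℂ) * (Real.sqrt (w m) : ℂ) = (w m : ℂ) := fun m => by
    rw [← Complex.ofReal_mul, Real.mul_self_sqrt (hw0 m)]
  set z₁ : μ → (Fin n ⊕ Fin n) → ℝ := fun m =>
    Sum.elim (fun a => gridTime β (2 * (2 * M)) (j a) - if 0 < -ξ m then β else 0)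
      (fun b => gridTime β (2 * (2 * M)) (l b)) with hz₁
  set z₂ : μ → (Fin n ⊕ Fin n) → ℝ := fun m =>
    Sum.elim (fun a => gridTime β (2 * (2 * M)) (j a))
      (fun b => gridTime β (2 * (2 * M)) (l b) - if -ξ m < 0 then β else 0) with hz₂
  have hV : ∀ (m : μ) (z : (Fin n ⊕ Fin n) → ℝ), ∃ V : (Fin n ⊕ Fin n) → (Fin n ⊕ Fin n) → ℂ,
      (∀ a b, ∑ r, star (V a r) * V b r = (Real.exp (-(|-ξ m| * |z a - z b|)) : ℂ)) ∧
        ∀ a, ∑ r, ‖V a r‖ ^ 2 = 1 := fun m z =>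
    (isPosDefKernel_exp_neg_mul_abs_sub (abs_nonneg (-ξ m))).exists_gram_vectors
      (fun y => by simp) z
  choose V₁ hV₁ hV₁n using fun m => hV m (z₁ m)
  choose V₂ hV₂ hV₂n using fun m => hV m (z₂ m)
  -- coordinates: K-block and R-block families, and their concatenations
  set uK : Fin n → (μ × (Fin n ⊕ Fin n)) → ℂ :=
    fun a x => F a x.1 * (Real.sqrt (w x.1) : ℂ) * star (V₁ x.1 (Sum.inl a) x.2) with huK
  set vK : Fin n → (μ × (Fin n ⊕ Fin n)) → ℂ :=
    fun b x => G b x.1 * (Real.sqrt (w x.1) : ℂ) * V₁ x.1 (Sum.inr b) x.2 with hvK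
  set pK : Fin n → (μ × (Fin n ⊕ Fin n)) → ℂ :=
    fun a x => F a x.1 * (Real.sqrt (w x.1) : ℂ) * star (V₂ x.1 (Sum.inl a) x.2) with hpK
  set qK : Fin n → (μ × (Fin n ⊕ Fin n)) → ℂ :=
    fun b x => -(G b x.1 * (Real.sqrt (w x.1) : ℂ) * V₂ x.1 (Sum.inr b) x.2) with hqK
  set uR : Fin n → (μ × MatsubaraIdx (2 * M)) → ℂ :=
    fun a y => F a y.1 * eJ a y.2 * D y.1 y.2 * (tR : ℂ) with huR
  set vR : Fin n → (μ × MatsubaraIdx (2 * M)) → ℂ :=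
    fun b y => G b y.1 * eL b y.2 * (((Real.sqrt T / β) : ℝ) : ℂ) with hvR
  set u : Fin n → (((μ × (Fin n ⊕ Fin n)) ⊕ (μ × MatsubaraIdx (2 * M))) ⊕ ν') → ℂ :=
    fun a => Sum.elim (Sum.elim (uK a) (uR a)) (P a) with hu
  set v : Fin n → (((μ × (Fin n ⊕ Fin n)) ⊕ (μ × MatsubaraIdx (2 * M))) ⊕ ν') → ℂ :=
    fun b => Sum.elim (Sum.elim (vK b) (vR b)) (Q b) with hv
  set p : Fin n → (((μ × (Fin n ⊕ Fin n)) ⊕ (μ × MatsubaraIdx (2 * M))) ⊕ ν') → ℂ :=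
    fun a => Sum.elim (Sum.elim (pK a) (uR a)) (P a) with hp
  set q : Fin n → (((μ × (Fin n ⊕ Fin n)) ⊕ (μ × MatsubaraIdx (2 * M))) ⊕ ν') → ℂ :=
    fun b => Sum.elim (Sum.elim (qK b) (vR b)) (Q b) with hq
  have hsplit_uv : ∀ a b, ∑ x, u a x * v b x =
      (∑ x, uK a x * vK b x + ∑ y, uR a y * vR b y) + ∑ m', P a m' * Q b m' := by
    intro a b
    simp only [hu, hv, Fintype.sum_sum_type, Sum.elim_inl, Sum.elim_inr]
  have hsplit_pq : ∀ a b, ∑ x, p a x * q b x =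
      (∑ x, pK a x * qK b x + ∑ y, uR a y * vR b y) + ∑ m', P a m' * Q b m' := by
    intro a b
    simp only [hp, hq, Fintype.sum_sum_type, Sum.elim_inl, Sum.elim_inr]
  -- the R-block realises `Σ_m F_a(m) G_b(m) β⁻¹ Σ_i e^{iν_i ε(l_b - j_a)} d_i(ξ_m)`
  have hR : ∀ a b : Fin n, ∑ y, uR a y * vR b y =
      ∑ m, F a m * G b m * (((1 / β : ℝ) : ℂ) * ∑ i : MatsubaraIdx (2 * M), eJ a i * eL b i * D m i) := by
    intro a b
    rw [Fintype.sum_prod_type]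
    refine Finset.sum_congr rfl fun m _ => ?_
    rw [Finset.mul_sum, Finset.mul_sum]
    refine Finset.sum_congr rfl fun i _ => ?_
    simp only [huR, hvR]
    rw [← htc]
    ring
  -- the K-block realises the chronological kernel (Pedra–Salmhofer Lemma 4.1)
  have honK : ∀ a b : Fin n, (l b : ℕ) ≤ (j a : ℕ) → ∑ x, uK a x * vK b x =
      ∑ m, F a m * G b m *
        ((Real.exp ((gridTime β (2 * (2 * M)) (j a) - gridTime β (2 * (2 * M)) (l b)) * (-ξ m)) *
          (1 + Real.exp (β * (-ξ m)))⁻¹ : ℝ) : ℂ) := by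
    intro a b hab
    have htsa : gridTime β (2 * (2 * M)) (l b) ≤ gridTime β (2 * (2 * M)) (j a) := hmono _ _ hab
    rw [Fintype.sum_prod_type]
    refine Finset.sum_congr rfl fun m _ => ?_
    have e1 : ∀ r, uK a (m, r) * vK b (m, r) = F a m * G b m * (w m : ℂ) *
        (star (V₁ m (Sum.inl a) r) * V₁ m (Sum.inr b) r) := by
      intro r
      simp only [huK, hvK]
      rw [← hsqw m]
      ring
    simp_rw [e1]
    rw [← Finset.mul_sum, hV₁ m, timeKernel_on_eq (-ξ m) β _ _ htsa (hgtβ _) (hgt0 _)]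
    simp only [hz₁, Sum.elim_inl, Sum.elim_inr, hw]
    push_cast
    ring_nf
  have hoffK : ∀ a b : Fin n, ¬ (l b : ℕ) ≤ (j a : ℕ) → ∑ x, pK a x * qK b x =
      -∑ m, F a m * G b m *
        ((Real.exp ((gridTime β (2 * (2 * M)) (j a) - gridTime β (2 * (2 * M)) (l b)) * (-ξ m)) *
          (1 + Real.exp (-(β * (-ξ m))))⁻¹ : ℝ) : ℂ) := by
    intro a b hab
    have hsat : gridTime β (2 * (2 * M)) (j a) ≤ gridTime β (2 * (2 * M)) (l b) :=
      hmono _ _ (Nat.le_of_lt (Nat.lt_of_not_le hab))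
    rw [Fintype.sum_prod_type, ← Finset.sum_neg_distrib]
    refine Finset.sum_congr rfl fun m _ => ?_
    have e1 : ∀ r, pK a (m, r) * qK b (m, r) = -(F a m * G b m * (w m : ℂ) *
        (star (V₂ m (Sum.inl a) r) * V₂ m (Sum.inr b) r)) := by
      intro r
      simp only [hpK, hqK]
      rw [← hsqw m]
      ring
    simp_rw [e1]
    rw [Finset.sum_neg_distrib, ← Finset.mul_sum, hV₂ m,
      timeKernel_off_eq (-ξ m) β _ _ hsat (hgt0 _) (hgtβ _)]
    simp only [hz₂, Sum.elim_inl, Sum.elim_inr, hw]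
    push_cast
    ring_nf
  -- the realisation as a chronological product
  have hM : (Matrix.of fun a b : Fin n =>
        (∑ m, F a m * G b m *
          (((1 / β : ℝ) : ℂ) * ∑ i' : MatsubaraIdx M,
            Complex.exp (-((matsubaraFreq β M i' *
                (gridTime β (2 * (2 * M)) (j a) - gridTime β (2 * (2 * M)) (l b)) : ℝ) : ℂ) * I) /
              (-((matsubaraFreq β M i' : ℝ) : ℂ) * I + (ξ m : ℂ)))) + ∑ m', P a m' * Q b m') =
      Matrix.of fun a b : Fin n =>
        if (l b : ℕ) ≤ (j a : ℕ) then ∑ x, u a x * v b x else ∑ x, p a x * q b x := by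
    ext a b
    simp only [Matrix.of_apply]
    rw [hentry a b]
    split_ifs with hab
    · rw [hsplit_uv, honK a b hab, hR]
    · rw [hsplit_pq, hoffK a b hab, hR]
  rw [hM]
  refine (norm_det_chronological_le_of_times' (J := ℕ) (fun a => (j a : ℕ)) (fun b => (l b : ℕ)) u v p q).trans ?_
  -- norms: K-blocks `≤ Σ_m |F_a(m)|²`, R-blocks `≤ 6 Σ_m |F_a(m)|²`
  have hnuK : ∀ a, ∑ x, ‖uK a x‖ ^ 2 ≤ ∑ m, ‖F a m‖ ^ 2 := by
    intro a
    rw [Fintype.sum_prod_type]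
    refine Finset.sum_le_sum fun m _ => ?_
    have e1 : ∀ r, ‖uK a (m, r)‖ ^ 2 = ‖F a m‖ ^ 2 * w m * ‖V₁ m (Sum.inl a) r‖ ^ 2 := by
      intro r
      simp only [huK, norm_mul, norm_star, Complex.norm_real, Real.norm_eq_abs,
        abs_of_nonneg (Real.sqrt_nonneg _), mul_pow, Real.sq_sqrt (hw0 m)]
    simp_rw [e1]
    rw [← Finset.mul_sum, hV₁n m, mul_one]
    exact mul_le_of_le_one_right (by positivity) (hw1 m)
  have hnpK : ∀ a, ∑ x, ‖pK a x‖ ^ 2 ≤ ∑ m, ‖F a m‖ ^ 2 := by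
    intro a
    rw [Fintype.sum_prod_type]
    refine Finset.sum_le_sum fun m _ => ?_
    have e1 : ∀ r, ‖pK a (m, r)‖ ^ 2 = ‖F a m‖ ^ 2 * w m * ‖V₂ m (Sum.inl a) r‖ ^ 2 := by
      intro r
      simp only [hpK, norm_mul, norm_star, Complex.norm_real, Real.norm_eq_abs,
        abs_of_nonneg (Real.sqrt_nonneg _), mul_pow, Real.sq_sqrt (hw0 m)]
    simp_rw [e1]
    rw [← Finset.mul_sum, hV₂n m, mul_one]
    exact mul_le_of_le_one_right (by positivity) (hw1 m)
  have hnvK : ∀ b, ∑ x, ‖vK b x‖ ^ 2 ≤ ∑ m, ‖G b m‖ ^ 2 := by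
    intro b
    rw [Fintype.sum_prod_type]
    refine Finset.sum_le_sum fun m _ => ?_
    have e1 : ∀ r, ‖vK b (m, r)‖ ^ 2 = ‖G b m‖ ^ 2 * w m * ‖V₁ m (Sum.inr b) r‖ ^ 2 := by
      intro r
      simp only [hvK, norm_mul, Complex.norm_real, Real.norm_eq_abs,
        abs_of_nonneg (Real.sqrt_nonneg _), mul_pow, Real.sq_sqrt (hw0 m)]
    simp_rw [e1]
    rw [← Finset.mul_sum, hV₁n m, mul_one]
    exact mul_le_of_le_one_right (by positivity) (hw1 m)
  have hnqK : ∀ b, ∑ x, ‖qK b x‖ ^ 2 ≤ ∑ m, ‖G b m‖ ^ 2 := by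
    intro b
    rw [Fintype.sum_prod_type]
    refine Finset.sum_le_sum fun m _ => ?_
    have e1 : ∀ r, ‖qK b (m, r)‖ ^ 2 = ‖G b m‖ ^ 2 * w m * ‖V₂ m (Sum.inr b) r‖ ^ 2 := by
      intro r
      simp only [hqK, norm_neg, norm_mul, Complex.norm_real, Real.norm_eq_abs,
        abs_of_nonneg (Real.sqrt_nonneg _), mul_pow, Real.sq_sqrt (hw0 m)]
    simp_rw [e1]
    rw [← Finset.mul_sum, hV₂n m, mul_one]
    exact mul_le_of_le_one_right (by positivity) (hw1 m)
  have hnuR : ∀ a, ∑ y, ‖uR a y‖ ^ 2 ≤ 6 * ∑ m, ‖F a m‖ ^ 2 := by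
    intro a
    rw [Fintype.sum_prod_type, Finset.mul_sum]
    refine Finset.sum_le_sum fun m _ => ?_
    have e1 : ∀ i, ‖uR a (m, i)‖ ^ 2 = ‖F a m‖ ^ 2 * (‖D m i‖ ^ 2 * tR ^ 2) := by
      intro i
      simp only [huR, norm_mul, Complex.norm_real, Real.norm_of_nonneg htR0.le]
      rw [hneJ]
      ring
    simp_rw [e1]
    rw [← Finset.mul_sum]
    have hsum : ∑ i : MatsubaraIdx (2 * M), ‖D m i‖ ^ 2 * tR ^ 2 ≤ 6 := by
      calc ∑ i : MatsubaraIdx (2 * M), ‖D m i‖ ^ 2 * tR ^ 2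
          ≤ ∑ _i : MatsubaraIdx (2 * M), (6 * (β / (2 * (2 * M) : ℕ))) ^ 2 * tR ^ 2 := by
            refine Finset.sum_le_sum fun i _ => ?_
            have h1 : ‖D m i‖ ^ 2 ≤ (6 * (β / (2 * (2 * M) : ℕ))) ^ 2 :=
              pow_le_pow_left₀ (norm_nonneg _) (hDle m i) 2
            exact mul_le_mul_of_nonneg_right h1 (sq_nonneg _)
        _ = 6 := by
            rw [Finset.sum_const, Finset.card_univ, nsmul_eq_mul, hcardR]
            exact hRrow
    calc ‖F a m‖ ^ 2 * ∑ i : MatsubaraIdx (2 * M), ‖D m i‖ ^ 2 * tR ^ 2 ≤ ‖F a m‖ ^ 2 * 6 :=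
          mul_le_mul_of_nonneg_left hsum (sq_nonneg _)
      _ = 6 * ‖F a m‖ ^ 2 := by ring
  have hnvR : ∀ b, ∑ y, ‖vR b y‖ ^ 2 ≤ 6 * ∑ m, ‖G b m‖ ^ 2 := by
    intro b
    rw [Fintype.sum_prod_type, Finset.mul_sum]
    refine Finset.sum_le_sum fun m _ => ?_
    have e1 : ∀ i, ‖vR b (m, i)‖ ^ 2 = ‖G b m‖ ^ 2 * (Real.sqrt T / β) ^ 2 := by
      intro i
      simp only [hvR, norm_mul, Complex.norm_real, Real.norm_of_nonneg hcβ]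
      rw [hneL]
      ring
    simp_rw [e1]
    rw [Finset.sum_const, Finset.card_univ, nsmul_eq_mul, hcardR]
    calc ((2 * (2 * M) : ℕ) : ℝ) * (‖G b m‖ ^ 2 * (Real.sqrt T / β) ^ 2)
        = (((2 * (2 * M) : ℕ) : ℝ) * (Real.sqrt T / β) ^ 2) * ‖G b m‖ ^ 2 := by ring
      _ = 6 * ‖G b m‖ ^ 2 := by rw [hRcol]
      _ ≤ 6 * ‖G b m‖ ^ 2 := le_rfl
  have hnu : ∀ a, ∑ x, ‖u a x‖ ^ 2 ≤ 7 * ∑ m, ‖F a m‖ ^ 2 + ∑ m', ‖P a m'‖ ^ 2 := by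
    intro a
    have : ∑ x, ‖u a x‖ ^ 2 = (∑ x, ‖uK a x‖ ^ 2 + ∑ y, ‖uR a y‖ ^ 2) + ∑ m', ‖P a m'‖ ^ 2 := by
      simp only [hu, Fintype.sum_sum_type, Sum.elim_inl, Sum.elim_inr]
    rw [this]
    linarith [hnuK a, hnuR a]
  have hnp : ∀ a, ∑ x, ‖p a x‖ ^ 2 ≤ 7 * ∑ m, ‖F a m‖ ^ 2 + ∑ m', ‖P a m'‖ ^ 2 := by
    intro a
    have : ∑ x, ‖p a x‖ ^ 2 = (∑ x, ‖pK a x‖ ^ 2 + ∑ y, ‖uR a y‖ ^ 2) + ∑ m', ‖P a m'‖ ^ 2 := by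
      simp only [hp, Fintype.sum_sum_type, Sum.elim_inl, Sum.elim_inr]
    rw [this]
    linarith [hnpK a, hnuR a]
  have hnv : ∀ b, ∑ x, ‖v b x‖ ^ 2 ≤ 7 * ∑ m, ‖G b m‖ ^ 2 + ∑ m', ‖Q b m'‖ ^ 2 := by
    intro b
    have : ∑ x, ‖v b x‖ ^ 2 = (∑ x, ‖vK b x‖ ^ 2 + ∑ y, ‖vR b y‖ ^ 2) + ∑ m', ‖Q b m'‖ ^ 2 := by
      simp only [hv, Fintype.sum_sum_type, Sum.elim_inl, Sum.elim_inr]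
    rw [this]
    linarith [hnvK b, hnvR b]
  have hnq : ∀ b, ∑ x, ‖q b x‖ ^ 2 ≤ 7 * ∑ m, ‖G b m‖ ^ 2 + ∑ m', ‖Q b m'‖ ^ 2 := by
    intro b
    have : ∑ x, ‖q b x‖ ^ 2 = (∑ x, ‖qK b x‖ ^ 2 + ∑ y, ‖vR b y‖ ^ 2) + ∑ m', ‖Q b m'‖ ^ 2 := by
      simp only [hq, Fintype.sum_sum_type, Sum.elim_inl, Sum.elim_inr]
    rw [this]
    linarith [hnqK b, hnvR b]
  -- assemble: `∏ √(‖u‖²+‖p‖²) ≤ (√14)ⁿ ∏ √(‖F_a‖² + ‖P_a‖²)`, same for columns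
  have hrow : (∏ a, Real.sqrt (∑ x, ‖u a x‖ ^ 2 + ∑ x, ‖p a x‖ ^ 2)) ≤
      (Real.sqrt 14) ^ n * ∏ a, Real.sqrt (∑ m, ‖F a m‖ ^ 2 + ∑ m', ‖P a m'‖ ^ 2) := by
    have : (Real.sqrt 14) ^ n * ∏ a, Real.sqrt (∑ m, ‖F a m‖ ^ 2 + ∑ m', ‖P a m'‖ ^ 2) =
        ∏ a : Fin n, (Real.sqrt 14 * Real.sqrt (∑ m, ‖F a m‖ ^ 2 + ∑ m', ‖P a m'‖ ^ 2)) := by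
      rw [Finset.prod_mul_distrib, Finset.prod_const, Finset.card_univ, Fintype.card_fin]
    rw [this]
    refine Finset.prod_le_prod (fun a _ => Real.sqrt_nonneg _) fun a _ => ?_
    rw [← Real.sqrt_mul (by norm_num : (0 : ℝ) ≤ 14)]
    have hP0 : 0 ≤ ∑ m', ‖P a m'‖ ^ 2 := Finset.sum_nonneg fun _ _ => sq_nonneg _
    exact Real.sqrt_le_sqrt (by linarith [hnu a, hnp a])
  have hcol : (∏ b, Real.sqrt (∑ x, ‖v b x‖ ^ 2 + ∑ x, ‖q b x‖ ^ 2)) ≤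
      (Real.sqrt 14) ^ n * ∏ b, Real.sqrt (∑ m, ‖G b m‖ ^ 2 + ∑ m', ‖Q b m'‖ ^ 2) := by
    have : (Real.sqrt 14) ^ n * ∏ b, Real.sqrt (∑ m, ‖G b m‖ ^ 2 + ∑ m', ‖Q b m'‖ ^ 2) =
        ∏ b : Fin n, (Real.sqrt 14 * Real.sqrt (∑ m, ‖G b m‖ ^ 2 + ∑ m', ‖Q b m'‖ ^ 2)) := by
      rw [Finset.prod_mul_distrib, Finset.prod_const, Finset.card_univ, Fintype.card_fin]
    rw [this]
    refine Finset.prod_le_prod (fun b _ => Real.sqrt_nonneg _) fun b _ => ?_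
    rw [← Real.sqrt_mul (by norm_num : (0 : ℝ) ≤ 14)]
    have hQ0 : 0 ≤ ∑ m', ‖Q b m'‖ ^ 2 := Finset.sum_nonneg fun _ _ => sq_nonneg _
    exact Real.sqrt_le_sqrt (by linarith [hnv b, hnq b])
  have h14n : (Real.sqrt 14) ^ n * (Real.sqrt 14) ^ n = 14 ^ n := by
    rw [← mul_pow, Real.mul_self_sqrt (by norm_num : (0 : ℝ) ≤ 14)]
  have hR0 : 0 ≤ (Real.sqrt 14) ^ n * ∏ a, Real.sqrt (∑ m, ‖F a m‖ ^ 2 + ∑ m', ‖P a m'‖ ^ 2) := by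
    positivity
  have hcol0 : 0 ≤ ∏ b, Real.sqrt (∑ x, ‖v b x‖ ^ 2 + ∑ x, ‖q b x‖ ^ 2) :=
    Finset.prod_nonneg fun b _ => Real.sqrt_nonneg _
  calc (∏ a, Real.sqrt (∑ x, ‖u a x‖ ^ 2 + ∑ x, ‖p a x‖ ^ 2)) *
        ∏ b, Real.sqrt (∑ x, ‖v b x‖ ^ 2 + ∑ x, ‖q b x‖ ^ 2)
      ≤ ((Real.sqrt 14) ^ n * ∏ a, Real.sqrt (∑ m, ‖F a m‖ ^ 2 + ∑ m', ‖P a m'‖ ^ 2)) *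
          ((Real.sqrt 14) ^ n * ∏ b, Real.sqrt (∑ m, ‖G b m‖ ^ 2 + ∑ m', ‖Q b m'‖ ^ 2)) :=
        mul_le_mul hrow hcol hcol0 hR0
    _ = 14 ^ n * ((∏ a, Real.sqrt (∑ m, ‖F a m‖ ^ 2 + ∑ m', ‖P a m'‖ ^ 2)) *
          ∏ b, Real.sqrt (∑ m, ‖G b m‖ ^ 2 + ∑ m', ‖Q b m'‖ ^ 2)) := by
        rw [← h14n]; ring


end Literature.MathematicalPhysics.QuantumLattice
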